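import Mathlib
import Literature.MathematicalPhysics.QuantumFieldTheory.MagnenRivasseauSeneor1993.MRS93InfinitesimalGauge
import Literature.Analysis.ODE.EvolutionMap
import HarnessLib

/-!
# Magnen–Rivasseau–Sénéor, *Construction of YM₄ with an infrared cutoff* (CMP 155, 1993) §II.A: the FINITE gauge
# transformations (II.4) and the exact covariance of the curvature (II.1)/(II.2); «g = e^{λγ}» versus (II.5)/(II.6);
# the axial gauge (II.7), its path-ordered exponential (II.8), and what (II.8) does on the TORUS — typed AS PRINTED

statement-level skeleton of a published construction CLAIM with citation tags; definitions with bodies and kernel-checked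
bookkeeping; nothing here is a claim about the Yang–Mills mass gap, about continuum YM₄ on T⁴ without infrared cutoff, or
about the Clay problem; nothing here bears on Bałaban's papers.

**Citation header (reproduction of PUBLISHED work).** J. Magnen, V. Rivasseau, R. Sénéor, *Construction of YM₄ with an
infrared cutoff*, Commun. Math. Phys. **155** (1993) 325–383 [MagnenRivasseauSeneor1993], §II.A pp.328–330 [PDF 4–6] (page
images `run/shared/lean/pub/lit-balaban/inprint/lit-balaban-p14/renders-cmp155/p04_full_s6.png`, `p05_full_s6.png`,
`p06_full_s6.png`; text layer `paper:magnen1993-cmp155-mrs-ym4-infrared-cutoff` p0004–p0006). Cell pub-balaban-gaps (YM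
blitz, track G3), seat mrs-lit-1 (gen 8); companion record `run/shared/lean/pub/pub-balaban-gaps/g3/MRS-AS-PRINTED.md` §2/§5.
Text-line locators («tl.») follow the running convention of this seat's files (displays counted once).

**Why this file.** Every G3 file so far QUOTES but does not type the finite gauge structure of §II.A:
`MRS93InfinitesimalGauge.lean` («(II.4) (finite gauge transformations A^g, group-valued g) and (II.8) (the path-ordered
exponential realising the axial gauge) are QUOTED, not typed … the EXACT invariance of the action under (II.4) is not
re-derived (only its first-order = infinitesimal form)») and `MRS93AxialWardIdentity.lean` («the FINITE gauge invariance
(II.4) and the exact Faddeev–Popov triviality … are quoted, not typed»). These are the hypotheses that say what «the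
Yang-Mills theory in the axial gauge» on the torus IS; they are pointwise algebra plus one-variable calculus, hence typable.

**What the paper prints (verbatim, from the page images).**
* p.328 tl.4–15: *«We consider the pure Yang-Mills theory with an infrared cutoff, which we never try to lift. This cutoff
  may be imposed on the propagator, or we could consider the theory on a finite volume with some boundary conditions, or on
  the sphere S⁴, the torus Λ = ℝ⁴/ℤ⁴ or another compact Riemannian fourdimensional manifold. Naive infrared regularization
  breaks gauge invariance, but compactification of space and the choice of a particular bundle with fiber G defines an
  unbroken group of gauge transformations. For instance in the case of the torus with the trivial SU(2) bundle, the gauge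
  transformation are simply the functions x → g(x) from ℝ⁴ to G which are periodic with period lattice ℤ⁴. … Moreover the
  constant fields or the zero mode in Fourier space is deleted in all our functional integrals, hence there is no infrared
  problem.»*
* p.328 tl.24–28: *«We write A = Σ_{a=1}^3 A^a t_a, with t_a = (iσ_a/2), where the σ's are the three usual hermitian Pauli
  matrices. With this convention the covariant derivative is D_μ = ∂_μ − λ[A_μ, ·]. We have Tr t_a t_b = −δ_ab/2. The field
  curvature is: F_μν = (∂_μA_ν − ∂_νA_μ) − λ[A_μ, A_ν] = (∂ ∧ A − λ[A, A]), (II.1)»*; (II.2): *«−½ ∫_Λ d⁴x Tr F_μν F^μν =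
  ¼ ∫_Λ d⁴x Σ_a F^a_μν F^{μνa}»*.
* p.329 tl.2–5: *«F² = F₂ + λF₃ + λ²F₄. (II.3) This action is invariant under the gauge transformations:
  A → A^g; (A^g)_μ = gA_μg⁻¹ + (1/λ) ∂_μg · g⁻¹. (II.4)»*
* p.329 tl.6–11: *«In what follows these gauge transformations are limited to a particular topological sector, for instance
  the functions from the compact space to G. It is often useful to consider the infinitesimal gauge transformations γ with
  values in the Lie algebra, which are tangent to the gauge transformations, such that g = e^{λγ}; the corresponding formula
  is: A → A^γ; (A^γ)_μ = A_μ + D_μγ, (II.5) where D = ∂ − λ[A, ·] is the covariant derivative.»*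
* p.329 tl.11–19: *«Finally for technical reasons it is also useful to introduce infinitesimal gauge transformations which
  correspond to expanding to a finite order in γ the exponential in (II.4). For instance we are interested in the regime
  where A ≅ λ^{−1/2−ε₁} and γ ≅ λ^{−1/2−ε₂}, where ε₁ and ε₂ are very small and we want to keep all terms not small as
  λ → 0. Then we should define A^{γ,2}_μ = A_μ + D_μγ + λ/2[γ, ∂_μγ]. (II.6) This "truncated" gauge transformed
  configuration A^{γ,2} is a polynomial of second order in γ and its derivatives. We could define further expansions of the
  gauge transformations; with these notations, if g = e^{λγ}, we have A^g = A^{γ,∞} and A^γ = A^{γ,1}.»*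
* p.329 tl.19–28: *«Our starting point is the Yang-Mills theory in the axial gauge. This gauge is defined by the condition
  A₀ = 0. (II.7) This is a gauge condition that can be imposed in the sense that for any field configuration A there is a
  gauge transformation such that A^g in (II.4) satisfies it; indeed we can take g = P exp(− ∫_{0,x⃗}^{x} A_μ dx^μ), (II.8)
  where the P means a path ordered exponential (limit of a Trotter product of exponentials along the path), and the path
  goes from {O, x⃗}, the point on the hyperplane x₀ = 0 to x, hence this path is parallel to the direction 0.»*
* p.329 tl.29–32: *«Remark that such an axial gauge condition a priori is not complete, in the sense that even after imposing
  it there remains a subgroup of the gauge group which acts still on the configurations satisfying (II.7), namely the gauge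
  transformations independent of x₀, the "time coordinate." We do not fix this remaining invariance yet.»*
* p.330 tl.3–5: *«Another advantage (perhaps related…) is that there is no Fadeev-Popov determinant in the axial gauge (more
  precisely it is a constant absorbed in the normalization), which is a big simplification.»*

**What is typed here (definitions with bodies; every theorem kernel-checked; zero `sorry`, zero named facts).**
* §1 (READING (M), normalisation (N)): `MatJet` (matrix-valued pointwise 1-jet of `A`), `GroupJet` (invertible value +
  first and second derivatives of `g` at the point; `GroupJet.invDer` = `∂(g⁻¹) = −g⁻¹∂g g⁻¹`, READING (J2), with
  `der_mul_inv_add`/`invDer_unique`: it is the unique value compatible with `∂(g g⁻¹) = 0`), `comm` (ring commutator),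
  `curvN` ((II.1) with the coupling absorbed, `B = λA`), **`gaugeActN`** ((II.4) times `λ`: `B ↦ gBg⁻¹ + ∂g g⁻¹`, values and
  first derivatives), **`curvN_gaugeActN`** (`F(B^g) = gF(B)g⁻¹` EXACTLY, every ring, every jet with symmetric `∂∂g`),
  `gaugeActN_val_eq_add_covD` (the exact tangent form `B^g = B + (D(g − 1))g⁻¹`), `gaugeActN_val_zero_of_axial` (at `B₀ = 0`:
  `(B^g)₀ = ∂₀g g⁻¹`, field-independent — the algebraic content of p.330 tl.3–5), `GroupJet.one`/`GroupJet.mul` and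
  **`gaugeActN_one`**, **`gaugeActN_mul`** (`(B^h)^g = B^{gh}`: the gauge transformations ACT, p.328 tl.9–10 «group of
  gauge transformations»), `GroupJet.inverse`/`GroupJet.mul_inverse`/**`gaugeActN_inverse_cancel`** (`(B^{g⁻¹})^g = B`).
* §2 (printed coupling): `curv c` ((II.1) verbatim, coupling `c`), **`gaugeAct c`** ((II.4) VERBATIM, `c⁻¹ = 1/λ`),
  `curvN_smul`/`gaugeAct_smul` (normalisation (N) intertwines), **`curv_gaugeAct`** (`F(A^g) = gF(A)g⁻¹`, `λ ≠ 0`),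
  `gaugeAct_val_eq_add_covD`, `gaugeAct_val_zero_of_axial`; `trace_conj_mul_conj` and **`trace_curv_sq_gaugeAct`** /
  `trace_curvN_sq_gaugeActN`: the (II.2) density `Σ_{μν} Tr F_μν F_μν` is INVARIANT under (II.4), exactly, pointwise, for
  matrices over any commutative ring of entries — «This action is invariant under the gauge transformations (II.4)»;
  for `G = SU(2) ⊂ U(2)`: `conj_skewHermitian`, `trace_conj`, `pureGauge_skewHermitian`, **`gaugeAct_val_skewHermitian`**
  ((II.4) keeps `A_μ` anti-Hermitian for unitary-valued `g` with the unitary Leibniz jet `∂g·g† + g·∂g† = 0`),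
  `pureGauge_traceless` (Jacobi at the jet level, `2 × 2`: `det g = 1` with unimodular jet ⟹ `Tr(∂g·g⁻¹) = 0`) and
  **`gaugeAct_val_traceless`** — together: for `SU(2)`-valued jets (II.4) maps `su(2)`-valued fields to `su(2)`-valued fields.
* §3 (dictionary + truncations): `toSu2_add/sub/smul`, `ofFieldJet`, `toSu2_bracket`, **`toSu2_curvature`** (the tree's
  component curvature `SectIV.curvature λ` with the printed wedge bracket IS `curv (−λ)` of the matrices `Σ_a A^a t_a` for
  the printed `t_a = iσ_a/2` — the sign precision of `Su2Conventions.tgen_commutator`, nothing new), `toSu2_covD`,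
  `fieldStrengthSq_eq_neg_two_trace` (the tree's `InfinitesimalGauge.fieldStrengthSq` IS `−2 Σ Tr F̂F̂`) and
  **`trace_curv_sq_gaugeAct_ofFieldJet`** (exact finite invariance of the tree's own `F²`: the (II.2) density of
  `(Σ_a A^a t_a)^g` equals `F²(A)` for every group 2-jet `g`);
  READING (T2): `expTrunc`/`expTruncInv` (order-2 Taylor polynomials of `e^{±sX}`), `expTrunc_mul_expTruncInv` (`= 1 + s⁴X⁴/4`),
  `dExpTrunc`, `litTrunc`, **`litTrunc_expand`** (the literal second-order expansion of (II.4) at `g = e^{sλγ}`, EXACT with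
  explicit `s³`, `s⁴` coefficients `litE3`, `litE4`), `truncIIsix` ((II.6) in normalisation (N)), **`truncGap`**,
  `firstOrder_eq_covD` (order `s¹` = `λ·Dγ`: (II.5) is the tangent of (II.4)), `secondOrder_printed_eq`,
  **`toSu2_gaugeTrunc2_val`** (the tree's `InfinitesimalGauge.gaugeTrunc2` = `truncIIsix`), `comm_comm_tgen`,
  `truncGap_witness_ne_zero`.
* §4 (READINGS (E), (PO), (AB)): `temporalComp` ((II.4) at `μ = 0` on `M₂(ℂ)`; `= gaugeAct.val 0` by
  `gaugeAct_val_zero_eq_temporalComp`), **`temporalComp_eq_zero_iff`** ((II.7) for `A^g` ⟺ `∂₀g = −λgA₀`, the equation of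
  the path-ordered exponential), **`solution_mul_invTransport_eq`** (READING (ADJ): given the inverse transport `U`,
  `∂₀U = λA₀U`, `U(0) = 1`, every solution has `g(t)U(t) = g(0)` — (II.8) is unique up to an `x⁰`-independent left
  factor; general `x⁰`-dependent `A₀`), **`invTransport_closes_of_periodic`** (a periodic axialising `g` forces
  `U(T) = 1`: the general form of precision (u)), **`invTransport_gauge_covariant`** +
  `invTransport_gauge_initial` + **`holonomy_trivial_iff_conj`** (the transport of `A^h` is `hUh(0)⁻¹`: the temporal
  holonomy is conjugated by periodic gauge transformations, its triviality is gauge-invariant), **`axial_preserved_iff_static`** (the residual group of tl.29–32 exactly: at an axial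
  configuration `A^g` is axial iff `∂₀g = 0`), `temporalComp_literal` (precision (w)), `cartan` (`A₀ = a·t₃`), `phase`, **`transport`**
  ((II.8) for the witness: `diag(e^{−iλat/2}, e^{iλat/2})`), `transport_zero`, `hasDerivAt_transport` (it solves the
  equation), `det_transport`, `transport_mul_star`, **`transport_mem_specialUnitaryGroup`**, **`temporalComp_transport`**
  (it reaches `A₀ = 0` along the LINE), **`transport_periodic_iff`** (it is `T`-periodic iff `λaT/(4π) ∈ ℤ`),
  **`holonomy_trivial_of_periodic_solution`**, **`no_periodic_gauge_to_axial`**, `transport_eq_one_iff`,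
  `cartan_mul_transport`, `cartan_neg`, `hasDerivAt_invTransport` (the witness's inverse transport `transport λ (−a)`),
  `holonomy_trivial_of_periodic_solution'` (the general closure theorem reproduces the explicit dichotomy),
  `exists_periodic_gauge_to_axial`, `hna_example`, `timeShift`, **`no_periodic_gauge_to_axial_torus`**.

**Readings (declared).** (M) MATRIX READING: fields are valued in an associative ring `R` (for MRS `R = M₂(ℂ) ⊃ su(2)`,
`A_μ = Σ_a A^a_μ t_a`) and `[·,·]` in (II.1)/(II.4)/(II.5) is the ring commutator — the [IZ] convention the print invokes
(p.328 tl.22–23); (II.4) involves the group element `g` itself (`gA_μg⁻¹`, `∂g·g⁻¹`), not only the bracket, so it is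
stated in the ambient matrix ring (the equivalent adjoint `SO(3)`-form on `ℝ³` is not typed). The dictionary to the tree's component files (bracket = printed wedge `ε`) is `toSu2_curvature`: coupling `−λ` for
the printed `t_a` (equivalently (II.1) verbatim for `t′_a = −iσ_a/2`), the sign precision already recorded in
`MRS93TruncatedGauge.lean` §su(2). (N) NORMALISATION `B = λA`, `X = λγ`: the identities are proved coupling-free and
transported to the printed coupling by `curvN_smul`/`gaugeAct_smul` (`λ ≠ 0`, as in the print's `1/λ`). (J2) JETS of `g`:
the statements are about the values of `g, ∂g, ∂∂g` at one point, `g(x)` invertible, `∂(g⁻¹) := −g⁻¹∂g g⁻¹` (forced by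
Leibniz, `invDer_unique`), `∂_μ∂_νg` symmetric where needed (true for `g ∈ C²`). (T2) «expanding to a finite order in γ the
exponential in (II.4)» = replacing `e^{±sλγ}` by its order-2 Taylor polynomial, `s` a grading parameter. (E) a
differentiable matrix-valued function of `x⁰` = entrywise `HasDerivAt`. (PO) the path-ordered exponential (II.8) is READ
as the solution of `∂₀g = −λ g A₀`, `g|_{x₀=0} = 1` (later times to the right; factor `λ` restored, precision (w)); for
the `x⁰`-independent diagonal witness it is the explicit `transport`. (ADJ) the inverse transport `U` (`∂₀U = λA₀U`,
`U(0) = 1`) enters the general statements as a datum; its existence (linear ODE theory) is not re-proved. (AB) the witness direction is the Cartan element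
`t₃`; (TOR) period `T > 0` in `x⁰` kept general (the print's `ℝ⁴/ℤ⁴` is `T = 1`).

**As-printed precisions (recorded, kernel-exhibited, NOT adjudicated).**
(u) TORUS CAVEAT. On `Λ = ℝ⁴/ℤ⁴` with the periodic gauge group of p.328 tl.10–12, the sentence p.329 tl.21–23 «for any
field configuration A there is a gauge transformation such that A^g in (II.4) satisfies [A₀ = 0]» FAILS: in general a
periodic axialising `g` forces the inverse temporal transport to close up, `U(T) = 1` (`invTransport_closes_of_periodic`,
from the uniqueness `solution_mul_invTransport_eq`); explicitly, for `A₀ ≡ a·t₃`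
with `λaT/(4π) ∉ ℤ` no `x⁰`-periodic, `x⁰`-differentiable, invertible-matrix-valued `g` (a fortiori no periodic
`SU(2)`-valued one) has `(A^g)₀ = 0` (`no_periodic_gauge_to_axial`, `…_torus`); (II.8) solves the equation along every
temporal LINE (`temporalComp_transport`) and closes up into a periodic transformation iff the temporal holonomy is trivial
(`transport_periodic_iff`, `exists_periodic_gauge_to_axial`). So the axial ansatz with `δ(A₀)` on `T⁴` ((II.9)–(II.10),
`MRS93AxialYMAction.lean`) reaches only gauge orbits of TRIVIAL TEMPORAL HOLONOMY (for `A₀ ≡ 0` the (II.8) equation reads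
`∂₀g = 0`); that it reaches all of them, up to the residual `x⁰`-independent transformations of tl.29–32, is the standard
converse ((II.8) is then periodic) and is NOT typed here. The sentence holds as printed on `ℝ⁴` or for an infrared cutoff
«imposed on the propagator» (p.328 tl.5). MRS's construction STARTS from the postulated axial-gauge measure («Our starting
point is …», tl.19; (II.9)); tl.21–23 is motivation and no typed statement of the tree depends on it, so nothing moves;
the precision records what «YM₄ on the torus in the axial gauge» covers.
(v) (II.6) versus «expanding … the exponential in (II.4)»: the literal second-order truncation of `A^{e^{λγ}}` in `γ` is
`A + Dγ + (λ/2)[γ, ∂γ] + (λ²/2)[γ, [γ, A]]` (`litTrunc_expand`); (II.6) omits the last term (`truncGap`, non-zero by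
`truncGap_witness_ne_zero`), which is of the size `λ²γ²A ≅ λ^{1/2−ε₁−2ε₂}` that tl.13–16 declares negligible — consistent
with «keep all terms not small as λ → 0», and with `T(γ)` of (II.41) being first order in `γ`; «A^γ = A^{γ,1}» is literal
(`firstOrder_eq_covD`).
(w) (II.8) prints «P exp(− ∫ A_μ dx^μ)» without `λ`; (II.4) as printed requires `∂₀g = −λgA₀` (`temporalComp_eq_zero_iff`);
literally one gets `(A^g)₀ = (1 − λ⁻¹) gA₀g⁻¹` (`temporalComp_literal`). Compare finding (k) (p.341 tl.20, missing `λ`).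

**Honest status / what is NOT claimed.** No function space, no smooth structure on `T⁴`, no measure: all of §1–§3 is
pointwise algebra on jets, §4 is one-variable calculus along a temporal circle. The adjoint representation `SU(2) → SO(3)`
is not typed — the identities hold in all of `M₂(ℂ)`; «`A^g` is again `su(2)`-valued» is typed on jets
(`gaugeAct_val_skewHermitian`, `gaugeAct_val_traceless`, with the unitary and unimodular Leibniz jet conditions as hypotheses).
Existence of the path-ordered exponential for `x⁰`-DEPENDENT `A₀` (linear ODE theory) is not re-proved; only its
defining equation is used, and the explicit solution for the `x⁰`-independent witness. «A^g = A^{γ,∞}» is typed to second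
order only (READING (T2)). The power-counting rationale of (II.6) is quoted, not adjudicated. Nothing of MRS's measure
(II.9)–(II.78), expansions or limits is touched; nothing here is continuum YM₄ on `T⁴` without infrared cutoff, nothing
lifts the infrared cutoff, nothing is a mass gap, nothing is Clay; nothing of Bałaban's.
-/

noncomputable section

namespace Literature.MathematicalPhysics.QuantumFieldTheory.MagnenRivasseauSeneor1993

namespace FiniteGauge

open Matrix

/-! ## §1 (II.1)/(II.4) on matrix-valued pointwise jets in a ring (READING (M)), normalisation `B = λA` (READING (N)) -/

section RingLevel

variable {R : Type*} [Ring R]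

/-- Pointwise 1-jet of a MATRIX-valued (Lie-algebra valued, [IZ] reading) vector potential at one point `x`:
`val μ = A_μ(x)`, `der μ ν = ∂_μA_ν(x)`, both in a ring `R` (for MRS: `R = M₂(ℂ)`, `A_μ = Σ_a A^a_μ t_a`, p.328 tl.24–26).
[cite: MagnenRivasseauSeneor1993, §II.A p.328 tl.24–28, (II.1)] -/
@[ext]
structure MatJet (R : Type*) where
  /-- `A_μ(x)`. -/
  val : Fin 4 → R
  /-- `∂_μ A_ν(x)`. -/
  der : Fin 4 → Fin 4 → R

/-- Pointwise 2-jet of a GROUP-valued gauge transformation `x ↦ g(x)` (p.328 tl.10–11 «the functions x → g(x) from ℝ⁴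
to G»): the invertible value `g(x)` and the values `∂_μg(x)`, `∂_μ∂_νg(x)` in the ambient ring (READING (J2)).
[cite: MagnenRivasseauSeneor1993, §II.A p.328 tl.9–11, (II.4) p.329 tl.4–5] -/
structure GroupJet (R : Type*) [Ring R] where
  /-- `g(x)`, invertible. -/
  unit : Rˣ
  /-- `∂_μ g(x)`. -/
  der : Fin 4 → R
  /-- `∂_μ∂_ν g(x)`. -/
  der2 : Fin 4 → Fin 4 → R

/-- Schwarz symmetry `∂_μ∂_νg = ∂_ν∂_μg` (true for `g ∈ C²`). [cite: MagnenRivasseauSeneor1993, §II.A (II.4) p.329] -/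
def GroupJet.Symm (G : GroupJet R) : Prop := ∀ μ ν, G.der2 μ ν = G.der2 ν μ

/-- The derivative of `g⁻¹` forced by the Leibniz rule on `g·g⁻¹ = 1`: `∂_μ(g⁻¹) = −g⁻¹(∂_μg)g⁻¹` (READING (J2)).
[cite: MagnenRivasseauSeneor1993, §II.A (II.4) p.329] -/
def GroupJet.invDer (G : GroupJet R) (μ : Fin 4) : R := -((↑G.unit⁻¹ : R) * G.der μ * (↑G.unit⁻¹ : R))

/-- Leibniz consistency of READING (J2): `∂_μ(g·g⁻¹) = (∂_μg)g⁻¹ + g ∂_μ(g⁻¹) = 0`.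
[cite: MagnenRivasseauSeneor1993, §II.A (II.4) p.329] -/
theorem GroupJet.der_mul_inv_add (G : GroupJet R) (μ : Fin 4) :
    G.der μ * (↑G.unit⁻¹ : R) + (G.unit : R) * G.invDer μ = 0 := by
  simp [GroupJet.invDer, ← mul_assoc]

/-- … and `∂_μ(g⁻¹)` is the ONLY value compatible with it: if `(∂_μg)g⁻¹ + g·e = 0` then `e = ∂_μ(g⁻¹)`.
[cite: MagnenRivasseauSeneor1993, §II.A (II.4) p.329] -/
theorem GroupJet.invDer_unique (G : GroupJet R) (μ : Fin 4) (e : R)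
    (h : G.der μ * (↑G.unit⁻¹ : R) + (G.unit : R) * e = 0) : e = G.invDer μ := by
  have h' : (G.unit : R) * e = -(G.der μ * (↑G.unit⁻¹ : R)) := eq_neg_of_add_eq_zero_right h
  calc e = (↑G.unit⁻¹ : R) * ((G.unit : R) * e) := by rw [Units.inv_mul_cancel_left]
    _ = G.invDer μ := by rw [h']; simp [GroupJet.invDer, mul_assoc]

/-- The ring commutator `[a, b] = ab − ba` (the Lie bracket of the [IZ] matrix reading, READING (M)).
[cite: MagnenRivasseauSeneor1993, §II.A p.328 tl.27–33] -/
def comm (a b : R) : R := a * b - b * a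

/-- `[b, a] = −[a, b]`. [cite: MagnenRivasseauSeneor1993, §II.A p.328 tl.32–33] -/
theorem comm_swap (a b : R) : comm b a = -comm a b := by
  simp [comm]

/-- (II.1) in the normalisation `B = λA` (READING (N), coupling absorbed): `F_μν(B) = ∂_μB_ν − ∂_νB_μ − [B_μ, B_ν]`
(`= λ·F_μν(A)`, see `curvN_smul`). [cite: MagnenRivasseauSeneor1993, §II.A (II.1) p.328] -/
def curvN (B : MatJet R) (μ ν : Fin 4) : R := B.der μ ν - B.der ν μ - comm (B.val μ) (B.val ν)

/-- `F_νμ = −F_μν`. [cite: MagnenRivasseauSeneor1993, §II.A (II.1) p.328] -/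
theorem curvN_antisymm (B : MatJet R) (μ ν : Fin 4) : curvN B ν μ = -curvN B μ ν := by
  simp only [curvN, comm]
  noncomm_ring

/-- **(II.4) in the normalisation `B = λA`**: «(A^g)_μ = gA_μg⁻¹ + (1/λ)∂_μg·g⁻¹» multiplied by `λ` reads
`(B^g)_ν = gB_νg⁻¹ + ∂_νg·g⁻¹` — values AND first derivatives (Leibniz, with `∂(g⁻¹)` of READING (J2)):
`∂_μ(B^g)_ν = ∂_μg B_ν g⁻¹ + g ∂_μB_ν g⁻¹ + g B_ν ∂_μ(g⁻¹) + ∂_μ∂_νg g⁻¹ + ∂_νg ∂_μ(g⁻¹)`.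
[cite: MagnenRivasseauSeneor1993, §II.A (II.4) p.329 tl.4–5] -/
def gaugeActN (G : GroupJet R) (B : MatJet R) : MatJet R where
  val ν := (G.unit : R) * B.val ν * (↑G.unit⁻¹ : R) + G.der ν * (↑G.unit⁻¹ : R)
  der μ ν := G.der μ * B.val ν * (↑G.unit⁻¹ : R) + (G.unit : R) * B.der μ ν * (↑G.unit⁻¹ : R)
    + (G.unit : R) * B.val ν * G.invDer μ + G.der2 μ ν * (↑G.unit⁻¹ : R) + G.der ν * G.invDer μ

/-- **«This action is invariant under the gauge transformations (II.4)» — the curvature is COVARIANT, exactly:**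
`F_μν(B^g) = g F_μν(B) g⁻¹` for every group 2-jet with symmetric second derivatives, every field jet, every pair of
indices, in every ring (all orders in `g`; the tree's `InfinitesimalGauge.curvature_gaugeInf` is the first order).
[cite: MagnenRivasseauSeneor1993, §II.A (II.3)–(II.4) p.329 tl.2–5] -/
theorem curvN_gaugeActN (G : GroupJet R) (hG : G.Symm) (B : MatJet R) (μ ν : Fin 4) :
    curvN (gaugeActN G B) μ ν = (G.unit : R) * curvN B μ ν * (↑G.unit⁻¹ : R) := by
  simp only [curvN, gaugeActN, comm, GroupJet.invDer, hG μ ν, mul_add, add_mul, mul_sub, sub_mul, mul_neg,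
    mul_assoc, Units.inv_mul_cancel_left]
  noncomm_ring

/-- The exact «tangent» form of (II.4): `(B^g)_ν = B_ν + (D_ν(g − 1))·g⁻¹` with `D_νh = ∂_νh − [B_ν, h]` the covariant
derivative of p.328 tl.27 (normalisation (N)) applied to `h = g − 1` (`∂h = ∂g`). For `g = e^{λγ} = 1 + λγ + O(γ²)` the
first order in `γ` is `λ·D_νγ`, i.e. (II.5) «(A^γ)_μ = A_μ + D_μγ» is the tangent of (II.4) at `g = 1`.
[cite: MagnenRivasseauSeneor1993, §II.A (II.4)–(II.5) p.329 tl.4–11] -/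
theorem gaugeActN_val_eq_add_covD (G : GroupJet R) (B : MatJet R) (ν : Fin 4) :
    (gaugeActN G B).val ν = B.val ν + (G.der ν - comm (B.val ν) ((G.unit : R) - 1)) * (↑G.unit⁻¹ : R) := by
  simp only [gaugeActN, comm, mul_sub, sub_mul, mul_one, one_mul, mul_assoc, Units.mul_inv]
  noncomm_ring

/-- At an AXIAL configuration (`B₀ = 0`, (II.7)) the time component after a gauge transformation is the pure-gauge term
alone, `(B^g)₀ = ∂₀g·g⁻¹` — it does not depend on `B`: the algebraic content of p.330 tl.3–5 «there is no Fadeev-Popov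
determinant in the axial gauge (more precisely it is a constant absorbed in the normalization)» (the variation of the gauge
condition along the orbit is field-independent). [cite: MagnenRivasseauSeneor1993, §II.A (II.7) p.329, p.330 tl.3–5] -/
theorem gaugeActN_val_zero_of_axial (G : GroupJet R) (B : MatJet R) (h0 : B.val 0 = 0) :
    (gaugeActN G B).val 0 = G.der 0 * (↑G.unit⁻¹ : R) := by
  simp [gaugeActN, h0]

/-- The identity gauge transformation `g ≡ 1` (`∂g = 0`, `∂∂g = 0`). [cite: MagnenRivasseauSeneor1993, §II.A (II.4) p.329] -/
def GroupJet.one : GroupJet R where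
  unit := 1
  der _ := 0
  der2 _ _ := 0

/-- The pointwise 2-jet of a product `x ↦ g(x)h(x)` (Leibniz: `∂(gh) = ∂g h + g ∂h`,
`∂_μ∂_ν(gh) = ∂_μ∂_νg h + ∂_νg ∂_μh + ∂_μg ∂_νh + g ∂_μ∂_νh`). [cite: MagnenRivasseauSeneor1993, §II.A p.328 tl.9–11, (II.4) p.329] -/
def GroupJet.mul (G H : GroupJet R) : GroupJet R where
  unit := G.unit * H.unit
  der μ := G.der μ * (H.unit : R) + (G.unit : R) * H.der μ
  der2 μ ν := G.der2 μ ν * (H.unit : R) + G.der ν * H.der μ + G.der μ * H.der ν + (G.unit : R) * H.der2 μ ν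

/-- `g ≡ 1` acts trivially: `B^1 = B` (values and derivatives). [cite: MagnenRivasseauSeneor1993, §II.A (II.4) p.329] -/
theorem gaugeActN_one (B : MatJet R) : gaugeActN GroupJet.one B = B := by
  ext μ ν <;> simp [gaugeActN, GroupJet.one, GroupJet.invDer]

/-- **The gauge transformations (II.4) form a GROUP ACTION** (p.328 tl.8–9 «an unbroken group of gauge transformations»):
`(B^h)^g = B^{gh}` — values and first derivatives, for all 2-jets `g, h` and every field jet.
[cite: MagnenRivasseauSeneor1993, §II.A p.328 tl.8–11, (II.4) p.329 tl.4–5] -/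
theorem gaugeActN_mul (G H : GroupJet R) (B : MatJet R) :
    gaugeActN G (gaugeActN H B) = gaugeActN (G.mul H) B := by
  ext μ ν
  · simp only [gaugeActN, GroupJet.mul, Units.val_mul, _root_.mul_inv_rev, mul_add, add_mul, mul_assoc,
      Units.mul_inv_cancel_left]
    abel
  · simp only [gaugeActN, GroupJet.mul, GroupJet.invDer, Units.val_mul, _root_.mul_inv_rev, mul_add, add_mul, mul_neg,
      neg_mul, mul_assoc, Units.mul_inv_cancel_left, Units.inv_mul_cancel_left]
    abel

/-- The pointwise 2-jet of the inverse transformation `x ↦ g(x)⁻¹`: value `g⁻¹`, `∂_μ(g⁻¹) = −g⁻¹∂_μg g⁻¹`,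
`∂_μ∂_ν(g⁻¹) = g⁻¹∂_μg g⁻¹∂_νg g⁻¹ − g⁻¹∂_μ∂_νg g⁻¹ + g⁻¹∂_νg g⁻¹∂_μg g⁻¹` (Leibniz twice).
[cite: MagnenRivasseauSeneor1993, §II.A p.328 tl.9–11, (II.4) p.329] -/
def GroupJet.inverse (G : GroupJet R) : GroupJet R where
  unit := G.unit⁻¹
  der μ := G.invDer μ
  der2 μ ν := (↑G.unit⁻¹ : R) * G.der μ * (↑G.unit⁻¹ : R) * G.der ν * (↑G.unit⁻¹ : R)
    - (↑G.unit⁻¹ : R) * G.der2 μ ν * (↑G.unit⁻¹ : R)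
    + (↑G.unit⁻¹ : R) * G.der ν * (↑G.unit⁻¹ : R) * G.der μ * (↑G.unit⁻¹ : R)

/-- `g · g⁻¹ ≡ 1` as 2-jets (all derivatives of the product vanish). [cite: MagnenRivasseauSeneor1993, §II.A p.328 tl.9–11, (II.4) p.329] -/
theorem GroupJet.mul_inverse (G : GroupJet R) : G.mul G.inverse = GroupJet.one := by
  simp only [GroupJet.mul, GroupJet.inverse, GroupJet.one, GroupJet.invDer, GroupJet.mk.injEq]
  refine ⟨mul_inv_cancel G.unit, ?_, ?_⟩
  · funext μ
    simp only [mul_neg, ← mul_assoc, Units.mul_inv, one_mul, add_neg_cancel]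
  · funext μ ν
    simp only [mul_add, mul_sub, mul_neg, ← mul_assoc, Units.mul_inv, one_mul]
    abel

/-- **Inverse gauge transformation:** `(B^{g⁻¹})^{g} = B` — with `gaugeActN_one`/`gaugeActN_mul`, the finite gauge
transformations (II.4) act as a GROUP on pointwise 1-jets (p.328 tl.9–10 «an unbroken group of gauge transformations»).
[cite: MagnenRivasseauSeneor1993, §II.A p.328 tl.9–11, (II.4) p.329 tl.4–5] -/
theorem gaugeActN_inverse_cancel (G : GroupJet R) (B : MatJet R) :
    gaugeActN G (gaugeActN G.inverse B) = B := by
  rw [gaugeActN_mul, GroupJet.mul_inverse, gaugeActN_one]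

end RingLevel

/-! ## §2 The printed coupling: (II.1), (II.4) verbatim with `λ`, and the trace form (II.2) of the action -/

section AlgebraLevel

variable {𝕜 : Type*} [Field 𝕜] {R : Type*} [Ring R] [Algebra 𝕜 R]

/-- Rescaling a field jet: `(c·A)_μ = c·A_μ`, `∂(c·A) = c·∂A` (the normalisation map `A ↦ B = λA`).
[cite: MagnenRivasseauSeneor1993, §II.A (II.1) p.328] -/
def MatJet.smul (c : 𝕜) (A : MatJet R) : MatJet R where
  val μ := c • A.val μ
  der μ ν := c • A.der μ ν

/-- **(II.1) with the printed coupling**, matrix reading (M): «F_μν = (∂_μA_ν − ∂_νA_μ) − λ[A_μ, A_ν]» with `[·,·]` the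
ring commutator and `λ = c`. [cite: MagnenRivasseauSeneor1993, §II.A (II.1) p.328 tl.29–30] -/
def curv (c : 𝕜) (A : MatJet R) (μ ν : Fin 4) : R := A.der μ ν - A.der ν μ - c • comm (A.val μ) (A.val ν)

/-- `F(λA)` in normalisation (N) is `λ·F_λ(A)`: `curvN (λ·A) = λ • curv λ A` (every `λ`, no inverse needed).
[cite: MagnenRivasseauSeneor1993, §II.A (II.1) p.328] -/
theorem curvN_smul (c : 𝕜) (A : MatJet R) (μ ν : Fin 4) : curvN (A.smul c) μ ν = c • curv c A μ ν := by
  simp only [curvN, curv, MatJet.smul, comm, smul_sub, mul_smul_comm, smul_mul_assoc, smul_smul]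

/-- **(II.4) VERBATIM**: «A → A^g; (A^g)_μ = gA_μg⁻¹ + (1/λ)∂_μg · g⁻¹» (coupling `λ = c`), values and first derivatives
(Leibniz with READING (J2)). [cite: MagnenRivasseauSeneor1993, §II.A (II.4) p.329 tl.4–5] -/
def gaugeAct (c : 𝕜) (G : GroupJet R) (A : MatJet R) : MatJet R where
  val ν := (G.unit : R) * A.val ν * (↑G.unit⁻¹ : R) + c⁻¹ • (G.der ν * (↑G.unit⁻¹ : R))
  der μ ν := G.der μ * A.val ν * (↑G.unit⁻¹ : R) + (G.unit : R) * A.der μ ν * (↑G.unit⁻¹ : R)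
    + (G.unit : R) * A.val ν * G.invDer μ + c⁻¹ • (G.der2 μ ν * (↑G.unit⁻¹ : R) + G.der ν * G.invDer μ)

/-- The displayed value: `(A^g)_ν = gA_νg⁻¹ + λ⁻¹ ∂_νg g⁻¹`. [cite: MagnenRivasseauSeneor1993, §II.A (II.4) p.329 tl.4–5] -/
theorem gaugeAct_val (c : 𝕜) (G : GroupJet R) (A : MatJet R) (ν : Fin 4) :
    (gaugeAct c G A).val ν = (G.unit : R) * A.val ν * (↑G.unit⁻¹ : R) + c⁻¹ • (G.der ν * (↑G.unit⁻¹ : R)) := rfl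

/-- Normalisation (N) intertwines the printed (II.4) with its coupling-free form: `λ·(A^g) = (λA)^g` (`λ ≠ 0`).
[cite: MagnenRivasseauSeneor1993, §II.A (II.4) p.329 tl.4–5] -/
theorem gaugeAct_smul (c : 𝕜) (hc : c ≠ 0) (G : GroupJet R) (A : MatJet R) :
    (gaugeAct c G A).smul c = gaugeActN G (A.smul c) := by
  ext μ ν
  · simp [MatJet.smul, gaugeAct, gaugeActN, smul_add, smul_smul, mul_inv_cancel₀ hc]
  · simp [MatJet.smul, gaugeAct, gaugeActN, smul_add, smul_smul, mul_inv_cancel₀ hc, add_assoc]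

/-- **(II.4) ⟹ F is covariant, with the printed coupling:** `F_μν(A^g) = g F_μν(A) g⁻¹` (`λ ≠ 0`; all orders in `g`).
[cite: MagnenRivasseauSeneor1993, §II.A (II.3)–(II.4) p.329 tl.2–5] -/
theorem curv_gaugeAct (c : 𝕜) (hc : c ≠ 0) (G : GroupJet R) (hG : G.Symm) (A : MatJet R) (μ ν : Fin 4) :
    curv c (gaugeAct c G A) μ ν = (G.unit : R) * curv c A μ ν * (↑G.unit⁻¹ : R) := by
  have h := curvN_gaugeActN G hG (A.smul c) μ ν
  rw [← gaugeAct_smul c hc, curvN_smul, curvN_smul, mul_smul_comm, smul_mul_assoc] at h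
  have h' := congrArg (fun x : R => c⁻¹ • x) h
  simpa only [smul_smul, inv_mul_cancel₀ hc, one_smul] using h'

/-- With the printed coupling: at an axial configuration `(A^g)₀ = λ⁻¹ ∂₀g·g⁻¹`, independent of `A` (p.330 tl.3–5).
[cite: MagnenRivasseauSeneor1993, §II.A (II.7) p.329, p.330 tl.3–5] -/
theorem gaugeAct_val_zero_of_axial (c : 𝕜) (G : GroupJet R) (A : MatJet R) (h0 : A.val 0 = 0) :
    (gaugeAct c G A).val 0 = c⁻¹ • (G.der 0 * (↑G.unit⁻¹ : R)) := by
  simp [gaugeAct, h0]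

/-- The exact tangent form with the printed coupling: `(A^g)_ν = A_ν + λ⁻¹·(D_ν(g − 1))·g⁻¹`, `D_νh = ∂_νh − λ[A_ν, h]`
— whose first order in `γ` at `g = e^{λγ} = 1 + λγ + …` is (II.5) «(A^γ)_μ = A_μ + D_μγ».
[cite: MagnenRivasseauSeneor1993, §II.A (II.4)–(II.5) p.329 tl.4–11] -/
theorem gaugeAct_val_eq_add_covD (c : 𝕜) (hc : c ≠ 0) (G : GroupJet R) (A : MatJet R) (ν : Fin 4) :
    (gaugeAct c G A).val ν =
      A.val ν + c⁻¹ • ((G.der ν - c • comm (A.val ν) ((G.unit : R) - 1)) * (↑G.unit⁻¹ : R)) := by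
  simp only [gaugeAct_val, comm, mul_sub, sub_mul, mul_one, one_mul, smul_sub, ← smul_mul_assoc, smul_smul,
    inv_mul_cancel₀ hc, one_smul, mul_assoc, Units.mul_inv]
  module

end AlgebraLevel

/-! ### (II.2): the trace form of the action density is invariant -/

section TraceLevel

variable {𝕜 : Type*} [Field 𝕜] {n : Type*} [Fintype n] [DecidableEq n] {S : Type*} [CommRing S] [Algebra 𝕜 S]

/-- Conjugation drops out of the trace of a product: `Tr(gXg⁻¹ · gYg⁻¹) = Tr(XY)`.
[cite: MagnenRivasseauSeneor1993, (II.2) p.328, (II.4) p.329] -/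
theorem trace_conj_mul_conj (u : (Matrix n n S)ˣ) (X Y : Matrix n n S) :
    Matrix.trace ((u : Matrix n n S) * X * (↑u⁻¹ : Matrix n n S) * ((u : Matrix n n S) * Y * (↑u⁻¹ : Matrix n n S)))
      = Matrix.trace (X * Y) := by
  have h1 : (u : Matrix n n S) * X * (↑u⁻¹ : Matrix n n S) * ((u : Matrix n n S) * Y * (↑u⁻¹ : Matrix n n S))
      = (u : Matrix n n S) * (X * Y * (↑u⁻¹ : Matrix n n S)) := by
    simp only [mul_assoc, Units.inv_mul_cancel_left]
  rw [h1, Matrix.trace_mul_comm, mul_assoc, mul_assoc, Units.inv_mul, mul_one]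

/-- **«This action is invariant under the gauge transformations (II.4)»** for the action density of (II.2)
«−½ Tr F_μν F^μν» (sum over the index pairs), EXACTLY, pointwise, for matrix-valued jets over any commutative ring
of entries: `Σ_{μν} Tr(F_μν(A^g) F_μν(A^g)) = Σ_{μν} Tr(F_μν(A) F_μν(A))` (`λ ≠ 0`, symmetric second derivatives of `g`).
The component form `¼ Σ_a (F^a_μν)²` of (II.2) is this trace by `Su2Conventions.actionDensity_II2`.
[cite: MagnenRivasseauSeneor1993, §II.A (II.2)–(II.4) pp.328–329] -/
theorem trace_curv_sq_gaugeAct (c : 𝕜) (hc : c ≠ 0) (G : GroupJet (Matrix n n S)) (hG : G.Symm)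
    (A : MatJet (Matrix n n S)) :
    ∑ μ, ∑ ν, Matrix.trace (curv c (gaugeAct c G A) μ ν * curv c (gaugeAct c G A) μ ν)
      = ∑ μ, ∑ ν, Matrix.trace (curv c A μ ν * curv c A μ ν) := by
  refine Finset.sum_congr rfl fun μ _ => Finset.sum_congr rfl fun ν _ => ?_
  rw [curv_gaugeAct c hc G hG A μ ν, trace_conj_mul_conj]

/-- The same in normalisation (N) (no coupling hypothesis). [cite: MagnenRivasseauSeneor1993, §II.A (II.2)–(II.4) pp.328–329] -/
theorem trace_curvN_sq_gaugeActN (G : GroupJet (Matrix n n S)) (hG : G.Symm) (B : MatJet (Matrix n n S)) :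
    ∑ μ, ∑ ν, Matrix.trace (curvN (gaugeActN G B) μ ν * curvN (gaugeActN G B) μ ν)
      = ∑ μ, ∑ ν, Matrix.trace (curvN B μ ν * curvN B μ ν) := by
  refine Finset.sum_congr rfl fun μ _ => Finset.sum_congr rfl fun ν _ => ?_
  rw [curvN_gaugeActN G hG B μ ν, trace_conj_mul_conj]

end TraceLevel

/-! ### `G = SU(2)`: (II.4) keeps the field anti-Hermitian (the `su(2)` condition, up to the trace of the pure-gauge term) -/

section UnitaryLevel

variable {n : Type*} [Fintype n] [DecidableEq n]

/-- For unitary `g` (`g g† = 1`) the matrix inverse is the adjoint. [cite: MagnenRivasseauSeneor1993, §II.A p.328 tl.10–11] -/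
theorem inv_eq_conjTranspose_of_unitary (g : Matrix n n ℂ) (hg : g * gᴴ = 1) : g⁻¹ = gᴴ :=
  Matrix.inv_eq_right_inv hg

/-- The homogeneous part of (II.4) preserves anti-Hermiticity: `g ∈ U(n)`, `X† = −X` ⟹ `(gXg⁻¹)† = −gXg⁻¹`
(`A_μ = Σ_a A^a_μ t_a` with `t_a = iσ_a/2` is anti-Hermitian, p.328 tl.24–26).
[cite: MagnenRivasseauSeneor1993, §II.A p.328 tl.10–11, tl.24–26, (II.4) p.329] -/
theorem conj_skewHermitian (g X : Matrix n n ℂ) (hg : g * gᴴ = 1) (hX : Xᴴ = -X) :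
    (g * X * g⁻¹)ᴴ = -(g * X * g⁻¹) := by
  rw [inv_eq_conjTranspose_of_unitary g hg, conjTranspose_mul, conjTranspose_mul, conjTranspose_conjTranspose, hX]
  simp [mul_assoc]

/-- … and the trace: `Tr(gXg⁻¹) = Tr X` (so traceless stays traceless). [cite: MagnenRivasseauSeneor1993, §II.A p.328 tl.24–28, (II.4) p.329] -/
theorem trace_conj (g X : Matrix n n ℂ) (hg : IsUnit g.det) : Matrix.trace (g * X * g⁻¹) = Matrix.trace X := by
  rw [Matrix.trace_mul_cycle, Matrix.nonsing_inv_mul _ hg, Matrix.one_mul]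

/-- The pure-gauge part of (II.4) is anti-Hermitian for a unitary-valued `g`: with the Leibniz jet condition of
`g g† ≡ 1`, `∂g·g† + g·∂g† = 0` (READING (J2) for unitarity), `(∂g·g⁻¹)† = −∂g·g⁻¹`. (Its tracelessness for
`det g ≡ 1` is `pureGauge_traceless` below.) [cite: MagnenRivasseauSeneor1993, §II.A p.328 tl.10–11, (II.4) p.329 tl.4–5] -/
theorem pureGauge_skewHermitian (g dg : Matrix n n ℂ) (hg : g * gᴴ = 1) (hL : dg * gᴴ + g * dgᴴ = 0) :
    (dg * g⁻¹)ᴴ = -(dg * g⁻¹) := by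
  rw [inv_eq_conjTranspose_of_unitary g hg, conjTranspose_mul, conjTranspose_conjTranspose]
  exact eq_neg_of_add_eq_zero_right hL

/-- **(II.4) maps anti-Hermitian fields to anti-Hermitian fields for unitary-valued `g` and real coupling:**
`(gA_μg⁻¹ + λ⁻¹∂_μg·g⁻¹)† = −(gA_μg⁻¹ + λ⁻¹∂_μg·g⁻¹)` — the value of `gaugeAct λ` at `μ` (`gaugeAct_val`).
[cite: MagnenRivasseauSeneor1993, §II.A p.328 tl.10–11, tl.24–26, (II.4) p.329 tl.4–5] -/
theorem gaugeAct_val_skewHermitian (c : ℝ) (g dg A : Matrix n n ℂ) (hg : g * gᴴ = 1)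
    (hL : dg * gᴴ + g * dgᴴ = 0) (hA : Aᴴ = -A) :
    (g * A * g⁻¹ + ((c : ℂ)⁻¹) • (dg * g⁻¹))ᴴ = -(g * A * g⁻¹ + ((c : ℂ)⁻¹) • (dg * g⁻¹)) := by
  rw [conjTranspose_add, conjTranspose_smul, conj_skewHermitian g A hg hA, pureGauge_skewHermitian g dg hg hL]
  have hc : star ((c : ℂ)⁻¹) = (c : ℂ)⁻¹ := by
    rw [star_inv₀, Complex.star_def, Complex.conj_ofReal]
  rw [hc, smul_neg, neg_add]

/-- **… and traceless for `det g ≡ 1` (`G = SU(2)`): Jacobi's formula at the jet level for `2 × 2` matrices.** With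
`det g(x) = 1` and the first jet of `det g` vanishing (`∂(g₀₀g₁₁ − g₀₁g₁₀) = 0`, Leibniz — READING (J2) for unimodularity),
`Tr(∂g·g⁻¹) = 0`. With `gaugeAct_val_skewHermitian` and `trace_conj`: for `SU(2)`-valued jets (II.4) maps
`su(2)`-valued `A_μ` (anti-Hermitian, traceless) to `su(2)`-valued `(A^g)_μ`.
[cite: MagnenRivasseauSeneor1993, §II.A p.328 tl.10–11, tl.24–28, (II.4) p.329 tl.4–5] -/
theorem pureGauge_traceless (g dg : Matrix (Fin 2) (Fin 2) ℂ) (hdet : g.det = 1)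
    (hjet : dg 0 0 * g 1 1 + g 0 0 * dg 1 1 - dg 0 1 * g 1 0 - g 0 1 * dg 1 0 = 0) :
    Matrix.trace (dg * g⁻¹) = 0 := by
  rw [Matrix.inv_def, hdet, Ring.inverse_one, one_smul, Matrix.adjugate_fin_two]
  simp [Matrix.trace, Matrix.mul_apply, Fin.sum_univ_two]
  linear_combination hjet

/-- Hence the full (II.4) value is traceless when `A_μ` is: `Tr(gA_μg⁻¹ + λ⁻¹∂_μg·g⁻¹) = 0` for `det g = 1` with
unimodular jet and `Tr A_μ = 0`. [cite: MagnenRivasseauSeneor1993, §II.A p.328 tl.10–11, tl.24–28, (II.4) p.329 tl.4–5] -/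
theorem gaugeAct_val_traceless (c : ℝ) (g dg A : Matrix (Fin 2) (Fin 2) ℂ) (hdet : g.det = 1)
    (hjet : dg 0 0 * g 1 1 + g 0 0 * dg 1 1 - dg 0 1 * g 1 0 - g 0 1 * dg 1 0 = 0) (hA : Matrix.trace A = 0) :
    Matrix.trace (g * A * g⁻¹ + ((c : ℂ)⁻¹) • (dg * g⁻¹)) = 0 := by
  have hu : IsUnit g.det := by rw [hdet]; exact isUnit_one
  rw [Matrix.trace_add, Matrix.trace_smul, trace_conj g A hu, hA, pureGauge_traceless g dg hdet hjet, smul_zero,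
    add_zero]

end UnitaryLevel

/-! ## §3 The tree's component conventions under `A = Σ_a A^a t_a`; (II.5) and (II.6) versus `g = e^{λγ}` -/

section Dictionary

open Su2Conventions TruncatedGauge InfinitesimalGauge SectIV

/-- `toSu2` is additive. [cite: MagnenRivasseauSeneor1993, §II.A p.328 tl.24–26] -/
theorem toSu2_add (X Y : Fin 3 → ℝ) : toSu2 (X + Y) = toSu2 X + toSu2 Y := by
  simp [toSu2, Finset.sum_add_distrib, add_smul]

/-- `toSu2` commutes with subtraction. [cite: MagnenRivasseauSeneor1993, §II.A p.328 tl.24–26] -/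
theorem toSu2_sub (X Y : Fin 3 → ℝ) : toSu2 (X - Y) = toSu2 X - toSu2 Y := by
  simp [toSu2, Finset.sum_sub_distrib, sub_smul]

/-- `toSu2` is real-homogeneous (real scalars act on `M₂(ℂ)` through `ℝ → ℂ`).
[cite: MagnenRivasseauSeneor1993, §II.A p.328 tl.24–26] -/
theorem toSu2_smul (r : ℝ) (X : Fin 3 → ℝ) : toSu2 (r • X) = (r : ℂ) • toSu2 X := by
  simp only [toSu2, Pi.smul_apply, smul_eq_mul, Complex.ofReal_mul, mul_smul, Finset.smul_sum]

/-- The tree's pointwise field jets (colour components, `SectIV.FieldJet`) as matrix jets: `A_μ ↦ Σ_a A^a_μ t_a` with the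
PRINTED `t_a = iσ_a/2`. [cite: MagnenRivasseauSeneor1993, §II.A p.328 tl.24–26] -/
def ofFieldJet (A : FieldJet) : MatJet (Matrix (Fin 2) (Fin 2) ℂ) where
  val μ := toSu2 (A.val μ)
  der μ ν := toSu2 (A.der μ ν)

/-- The printed wedge bracket is MINUS the matrix commutator for the printed `t_a` (`Su2Conventions.toSu2_commutator`):
`[X, Y]^ = −(X̂Ŷ − ŶX̂)`. [cite: MagnenRivasseauSeneor1993, §II.A p.328 tl.32–33] -/
theorem toSu2_bracket (X Y : Fin 3 → ℝ) : toSu2 (bracket X Y) = -comm (toSu2 X) (toSu2 Y) := by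
  rw [comm, toSu2_commutator, neg_neg]

/-- **Dictionary for (II.1).** The tree's component curvature `SectIV.curvature λ A` (bracket = printed wedge) is, as a
matrix `Σ_a F^a t_a`, the matrix-reading curvature (II.1) with coupling `−λ`: `F̂ = ∂Â − ∂Â − (−λ)[Â, Â]` — the sign
precision already recorded in `Su2Conventions.tgen_commutator` (printed `t_a = iσ_a/2` has structure constants `−ε`);
equivalently (II.1) verbatim for `t′_a = −iσ_a/2`. [cite: MagnenRivasseauSeneor1993, §II.A (II.1) p.328 tl.24–33] -/
theorem toSu2_curvature (lam : ℝ) (A : FieldJet) (μ ν : Fin 4) :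
    toSu2 (curvature lam A μ ν) = curv (-(lam : ℂ)) (ofFieldJet A) μ ν := by
  simp only [curvature, curv, ofFieldJet, toSu2_sub, toSu2_smul, toSu2_bracket, smul_neg, neg_smul, sub_neg_eq_add]

/-- **Dictionary for the covariant derivative** «D_μ = ∂_μ − λ[A_μ, ·]» (p.328 tl.27) applied to `γ`:
`(D_μγ)^ = ∂_μγ̂ − (−λ)(Â_μγ̂ − γ̂Â_μ)`. [cite: MagnenRivasseauSeneor1993, §II.A p.328 tl.27, (II.5) p.329] -/
theorem toSu2_covD (lam : ℝ) (A : FieldJet) (γ : GaugeJet) (μ : Fin 4) :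
    toSu2 (covD lam A γ μ) = toSu2 (γ.der μ) - (-(lam : ℂ)) • comm (toSu2 (A.val μ)) (toSu2 γ.val) := by
  simp only [covD, toSu2_sub, toSu2_smul, toSu2_bracket, smul_neg, neg_smul]

/-- **The tree's `F²` IS the (II.2) trace density.** For a component jet `A` (`SectIV.FieldJet`), the tree's
`InfinitesimalGauge.fieldStrengthSq λ A = Σ_{μνa} (F^a_μν)²` equals `−2 Σ_{μν} Tr(F̂_μν F̂_μν)` of the matrix jet `Σ_a A^a t_a`
(by `Su2Conventions.actionDensity_II2` and `toSu2_curvature`). [cite: MagnenRivasseauSeneor1993, §II.A (II.1)–(II.2) p.328] -/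
theorem fieldStrengthSq_eq_neg_two_trace (lam : ℝ) (A : FieldJet) :
    ((fieldStrengthSq lam A : ℝ) : ℂ) =
      -2 * ∑ μ, ∑ ν, Matrix.trace (curv (-(lam : ℂ)) (ofFieldJet A) μ ν * curv (-(lam : ℂ)) (ofFieldJet A) μ ν) := by
  simp only [fieldStrengthSq, ← toSu2_curvature]
  push_cast
  rw [Finset.mul_sum]
  refine Finset.sum_congr rfl fun μ _ => ?_
  rw [Finset.mul_sum]
  refine Finset.sum_congr rfl fun ν _ => ?_
  have h := actionDensity_II2 (curvature lam A μ ν)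
  push_cast at h
  linear_combination (-4 : ℂ) * h

/-- **Exact finite gauge invariance of the tree's own `F²`:** for EVERY group 2-jet `g` (symmetric second derivatives) on
`M₂(ℂ)`, the (II.2) trace density of the transformed matrix field `(Σ_a A^a t_a)^g` (transformation (II.4) with the
coupling `−λ` of the dictionary `toSu2_curvature`) equals `F²(A)` of the original component field — all orders, not only
the first order of `InfinitesimalGauge.fieldStrengthSq_gaugeInf`. [cite: MagnenRivasseauSeneor1993, §II.A (II.2)–(II.4) pp.328–329] -/
theorem trace_curv_sq_gaugeAct_ofFieldJet (lam : ℝ) (hlam : lam ≠ 0) (G : GroupJet (Matrix (Fin 2) (Fin 2) ℂ))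
    (hG : G.Symm) (A : FieldJet) :
    -2 * ∑ μ, ∑ ν, Matrix.trace (curv (-(lam : ℂ)) (gaugeAct (-(lam : ℂ)) G (ofFieldJet A)) μ ν
        * curv (-(lam : ℂ)) (gaugeAct (-(lam : ℂ)) G (ofFieldJet A)) μ ν) = ((fieldStrengthSq lam A : ℝ) : ℂ) := by
  have hc : (-(lam : ℂ)) ≠ 0 := neg_ne_zero.2 (by exact_mod_cast hlam)
  rw [trace_curv_sq_gaugeAct _ hc G hG, fieldStrengthSq_eq_neg_two_trace]

end Dictionary

section Truncation

variable {𝕜 : Type*} [Field 𝕜] [CharZero 𝕜] {R : Type*} [Ring R] [Algebra 𝕜 R]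

/-- The order-2 Taylor polynomial of `s ↦ e^{sX}`: `1 + sX + (s²/2)X²` (READING (T2): «expanding to a finite order in γ the
exponential in (II.4)», p.329 tl.12–13, with `X = λγ̂`, grading parameter `s`).
[cite: MagnenRivasseauSeneor1993, §II.A p.329 tl.11–13, (II.6)] -/
def expTrunc (s : 𝕜) (X : R) : R := 1 + s • X + (s ^ 2 / 2) • (X * X)

/-- The order-2 Taylor polynomial of `s ↦ e^{−sX} = (e^{sX})⁻¹`: `1 − sX + (s²/2)X²`.
[cite: MagnenRivasseauSeneor1993, §II.A p.329 tl.11–13, (II.6)] -/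
def expTruncInv (s : 𝕜) (X : R) : R := 1 - s • X + (s ^ 2 / 2) • (X * X)

/-- The two truncations are inverse to each other up to order 4 EXACTLY: `(1 + sX + s²X²/2)(1 − sX + s²X²/2) = 1 + s⁴X⁴/4`
(so replacing `g⁻¹` by `expTruncInv` changes nothing below order `s³`). [cite: MagnenRivasseauSeneor1993, §II.A p.329 tl.11–13] -/
theorem expTrunc_mul_expTruncInv (s : 𝕜) (X : R) :
    expTrunc s X * expTruncInv s X = 1 + (s ^ 4 / 4) • (X * X * X * X) := by
  simp only [expTrunc, expTruncInv, mul_add, add_mul, mul_sub, one_mul, mul_one, smul_mul_assoc,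
    mul_smul_comm, mul_assoc]
  module

/-- The first derivatives of `expTrunc s X` by Leibniz: `∂(sX + s²X²/2) = s∂X + (s²/2)(∂X·X + X·∂X)`.
[cite: MagnenRivasseauSeneor1993, §II.A p.329 tl.11–13, (II.6)] -/
def dExpTrunc (s : 𝕜) (X dX : R) : R := s • dX + (s ^ 2 / 2) • (dX * X + X * dX)

/-- **(II.4) at `g = e^{sλγ}` expanded LITERALLY to second order**, in normalisation (N) (`B = λÂ`, `X = λγ̂`, `∂X = λ∂γ̂`):
`λ·(A^g)_μ ≈ e^{sX} B_μ e^{−sX} + (∂_μ e^{sX}) e^{−sX}` with both exponentials replaced by their order-2 Taylor polynomials.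
[cite: MagnenRivasseauSeneor1993, §II.A (II.4)–(II.6) p.329 tl.4–18] -/
def litTrunc (s : 𝕜) (B X dX : R) : R :=
  expTrunc s X * B * expTruncInv s X + dExpTrunc s X dX * expTruncInv s X

/-- The `s³`-coefficient of `litTrunc` (explicit; irrelevant to the second order).
[cite: MagnenRivasseauSeneor1993, §II.A (II.6) p.329] -/
def litE3 (B X dX : R) : R :=
  (1 / 2 : 𝕜) • (X * B * (X * X) - X * X * B * X) - (1 / 2 : 𝕜) • (X * dX * X)

/-- The `s⁴`-coefficient of `litTrunc` (explicit; irrelevant to the second order).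
[cite: MagnenRivasseauSeneor1993, §II.A (II.6) p.329] -/
def litE4 (B X dX : R) : R :=
  (1 / 4 : 𝕜) • (X * X * B * (X * X) + dX * X * (X * X) + X * dX * (X * X))

/-- **The literal second-order expansion of (II.4) at `g = e^{λγ}`, EXACTLY (kernel):**
`λ(A^g)_μ = B_μ + s(∂_μX + [X, B_μ]) + s²(½[X, ∂_μX] + ½[X, [X, B_μ]]) + s³E₃ + s⁴E₄`.
Order `s¹` is `λ·D_μγ` — (II.5) is the tangent of (II.4) («γ … tangent to the gauge transformations, such that
g = e^{λγ}», p.329 tl.8–10). Order `s²` is `λ·(λ/2)[γ, ∂_μγ]` — the quadratic term PRINTED in (II.6) — PLUS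
`½[X,[X,B_μ]] = λ·(λ²/2)[γ,[γ,A_μ]]`, which (II.6) does NOT carry: AS-PRINTED PRECISION (v), see `truncGap`.
[cite: MagnenRivasseauSeneor1993, §II.A (II.4)–(II.6) p.329 tl.4–18] -/
theorem litTrunc_expand (s : 𝕜) (B X dX : R) :
    litTrunc s B X dX =
      B + s • (dX + comm X B) + s ^ 2 • ((1 / 2 : 𝕜) • comm X dX + (1 / 2 : 𝕜) • comm X (comm X B))
        + s ^ 3 • litE3 (𝕜 := 𝕜) B X dX + s ^ 4 • litE4 (𝕜 := 𝕜) B X dX := by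
  simp only [litTrunc, expTrunc, expTruncInv, dExpTrunc, litE3, litE4, comm, mul_add, add_mul, mul_sub, sub_mul,
    one_mul, mul_one, smul_mul_assoc, mul_smul_comm, smul_add, smul_sub, smul_smul, mul_assoc]
  module

/-- (II.6) in normalisation (N): `λ·A^{γ,2}_μ = B_μ + (∂_μX + [X, B_μ]) + ½[X, ∂_μX]` («A_μ + D_μγ + λ/2[γ, ∂_μγ]»
times `λ`, with `X = λγ̂`, matrix reading). [cite: MagnenRivasseauSeneor1993, §II.A (II.6) p.329 tl.16] -/
def truncIIsix (B X dX : R) : R := B + (dX + comm X B) + (1 / 2 : 𝕜) • comm X dX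

omit [CharZero 𝕜] in
/-- **PRECISION (v), kernel form.** The literal second-order truncation (orders `s⁰, s¹, s²` of `litTrunc_expand` at
`s = 1`) exceeds (II.6) by exactly `½[X,[X,B_μ]]` (`= λ·(λ²/2)[γ,[γ,A_μ]]`): a term of second order in `γ` — of the size
`λ²γ²A ≅ λ^{1/2−ε₁−2ε₂}` that p.329 tl.13–16 declares negligible («we want to keep all terms not small as λ → 0») — so
(II.6) is «second order in γ, dropping the terms small as λ → 0», not the literal Taylor truncation of «the exponential in
(II.4)»; `T(γ)` of (II.41) is accordingly first order in `γ`. Recorded, not adjudicated; nothing downstream in the print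
uses the literal truncation. [cite: MagnenRivasseauSeneor1993, §II.A (II.6) p.329 tl.11–18, (II.41) p.341] -/
theorem truncGap (B X dX : R) :
    (B + (1 : 𝕜) • (dX + comm X B) + (1 : 𝕜) ^ 2 • ((1 / 2 : 𝕜) • comm X dX + (1 / 2 : 𝕜) • comm X (comm X B)))
      - truncIIsix (𝕜 := 𝕜) B X dX = (1 / 2 : 𝕜) • comm X (comm X B) := by
  simp only [truncIIsix, one_smul, one_pow, smul_add]
  abel

end Truncation

section TruncationWitness

open Su2Conventions TruncatedGauge InfinitesimalGauge SectIV

/-- **Dictionary for (II.5)/(II.6), first order.** With `c = −λ` (the matrix coupling of the tree's conventions,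
`toSu2_curvature`), `B = cÂ`, `X = cγ̂`, `∂X = c∂γ̂`: the order-`s¹` coefficient of `litTrunc_expand` is `c·(D_μγ)^`,
the matrix of the tree's `InfinitesimalGauge.covD` — (II.5) IS the tangent of (II.4).
[cite: MagnenRivasseauSeneor1993, §II.A (II.4)–(II.5) p.329 tl.4–11] -/
theorem firstOrder_eq_covD (lam : ℝ) (A : FieldJet) (γ : GaugeJet) (μ : Fin 4) :
    (-(lam : ℂ)) • toSu2 (γ.der μ) + comm ((-(lam : ℂ)) • toSu2 γ.val) ((-(lam : ℂ)) • toSu2 (A.val μ))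
      = (-(lam : ℂ)) • toSu2 (covD lam A γ μ) := by
  rw [toSu2_covD]
  simp only [comm, smul_sub, smul_mul_assoc, mul_smul_comm, smul_smul, comm]
  module

/-- **Dictionary for (II.6), second order.** With the same substitutions the quadratic term PRINTED in (II.6),
`(λ/2)[γ, ∂_μγ]` (tree: `(lam/2) • bracket γ.val (γ.der μ)` in `InfinitesimalGauge.gaugeTrunc2`), times `c`, is
`½[X, ∂_μX]` — the first half of the order-`s²` coefficient of `litTrunc_expand`; the other half `½[X,[X,B_μ]]` is the
gap of precision (v). [cite: MagnenRivasseauSeneor1993, §II.A (II.6) p.329 tl.16] -/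
theorem secondOrder_printed_eq (lam : ℝ) (γ : GaugeJet) (μ : Fin 4) :
    (-(lam : ℂ)) • toSu2 ((lam / 2) • bracket γ.val (γ.der μ))
      = (1 / 2 : ℂ) • comm ((-(lam : ℂ)) • toSu2 γ.val) ((-(lam : ℂ)) • toSu2 (γ.der μ)) := by
  rw [toSu2_smul, toSu2_bracket]
  simp only [comm, smul_sub, neg_sub, smul_mul_assoc, mul_smul_comm, smul_smul]
  push_cast
  module

/-- (II.6)'s value in the tree (`InfinitesimalGauge.gaugeTrunc2`), mapped to matrices and multiplied by `c = −λ`, IS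
`truncIIsix` of the substituted variables: the tree's (II.6) and this file's agree exactly.
[cite: MagnenRivasseauSeneor1993, §II.A (II.6) p.329 tl.16] -/
theorem toSu2_gaugeTrunc2_val (lam : ℝ) (A : FieldJet) (γ : GaugeJet) (μ : Fin 4) :
    (-(lam : ℂ)) • toSu2 ((gaugeTrunc2 lam A γ).val μ)
      = truncIIsix (𝕜 := ℂ) ((-(lam : ℂ)) • toSu2 (A.val μ)) ((-(lam : ℂ)) • toSu2 γ.val)
          ((-(lam : ℂ)) • toSu2 (γ.der μ)) := by
  have h1 := firstOrder_eq_covD lam A γ μ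
  have h2 := secondOrder_printed_eq lam γ μ
  simp only [gaugeTrunc2, truncIIsix, toSu2_add, smul_add]
  rw [← h1, h2]

/-- The gap term does not vanish in general — Pauli witness: `[t₁, [t₁, t₂]] = −t₂` for the printed generators
(indices `0, 1`). [cite: MagnenRivasseauSeneor1993, §II.A p.328 tl.26–29, (II.6) p.329] -/
theorem comm_comm_tgen : comm (tgen 0) (comm (tgen 0) (tgen 1)) = -tgen 1 := by
  ext i j
  fin_cases i <;> fin_cases j <;> simp [comm, tgen, pauli] <;> ring_nf <;>
    simp [Complex.I_sq, Complex.I_pow_four] <;> norm_num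

/-- … and `t₂ ≠ 0`, so for `X = t₁`, `B_μ = t₂` the precision-(v) term `½[X,[X,B_μ]] = −½t₂ ≠ 0`.
[cite: MagnenRivasseauSeneor1993, §II.A p.328 tl.26–29, (II.6) p.329] -/
theorem truncGap_witness_ne_zero : (1 / 2 : ℂ) • comm (tgen 0) (comm (tgen 0) (tgen 1)) ≠ 0 := by
  rw [comm_comm_tgen]
  intro h
  have h' := congrArg (fun M : Matrix (Fin 2) (Fin 2) ℂ => M 0 1) h
  simp [tgen, pauli] at h'

end TruncationWitness

/-! ## §4 (II.7)/(II.8): the axial gauge, its attainability, and the torus -/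

section AxialGauge

open Su2Conventions Complex

/-- **(II.4) at `μ = 0` along a temporal line**, for `2 × 2` complex matrices (`G = SU(2) ⊂ GL₂(ℂ)`):
`(A^g)₀ = g A₀ g⁻¹ + λ⁻¹ (∂₀g) g⁻¹` as a function of the values `g(x)`, `∂₀g(x)`, `A₀(x)` (`g⁻¹` = `Matrix.inv`).
[cite: MagnenRivasseauSeneor1993, §II.A (II.4) p.329 tl.4–5, (II.7) tl.20] -/
def temporalComp (lam : ℝ) (g dg A0 : Matrix (Fin 2) (Fin 2) ℂ) : Matrix (Fin 2) (Fin 2) ℂ :=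
  g * A0 * g⁻¹ + ((lam : ℂ)⁻¹) • (dg * g⁻¹)

/-- `temporalComp` IS the time component of (II.4) (`gaugeAct`, §2) for `R = M₂(ℂ)`, coupling `λ ∈ ℝ ⊂ ℂ`.
[cite: MagnenRivasseauSeneor1993, §II.A (II.4) p.329 tl.4–5, (II.7) tl.20] -/
theorem gaugeAct_val_zero_eq_temporalComp (lam : ℝ) (G : GroupJet (Matrix (Fin 2) (Fin 2) ℂ))
    (A : MatJet (Matrix (Fin 2) (Fin 2) ℂ)) :
    (gaugeAct (lam : ℂ) G A).val 0 = temporalComp lam (G.unit : Matrix (Fin 2) (Fin 2) ℂ) (G.der 0) (A.val 0) := by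
  simp [gaugeAct, temporalComp, Matrix.coe_units_inv]

/-- **The algebraic content of (II.7)/(II.8):** for invertible `g(x)`, the axial condition «A₀ = 0. (II.7)» for `A^g`
holds iff `∂₀g = −λ g A₀` — the differential equation solved by a path-ordered exponential along the direction 0
(p.329 tl.24–28; READING (PO): later times to the right, factor `λ` restored — see `temporalComp_literal`).
[cite: MagnenRivasseauSeneor1993, §II.A (II.7)–(II.8) p.329 tl.19–28] -/
theorem temporalComp_eq_zero_iff (lam : ℝ) (hlam : lam ≠ 0) {g : Matrix (Fin 2) (Fin 2) ℂ} (hg : IsUnit g.det)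
    (dg A0 : Matrix (Fin 2) (Fin 2) ℂ) :
    temporalComp lam g dg A0 = 0 ↔ dg = -((lam : ℂ) • (g * A0)) := by
  have hlam' : (lam : ℂ) ≠ 0 := by exact_mod_cast hlam
  constructor
  · intro h
    have h1 := congrArg (fun M : Matrix (Fin 2) (Fin 2) ℂ => (lam : ℂ) • (M * g)) h
    simp only [temporalComp, add_mul, smul_mul_assoc, Matrix.nonsing_inv_mul_cancel_right _ _ hg, smul_add, smul_smul,
      mul_inv_cancel₀ hlam', one_smul, Matrix.zero_mul, smul_zero] at h1
    rw [add_comm] at h1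
    exact eq_neg_of_add_eq_zero_left h1
  · intro h
    subst h
    simp only [temporalComp, Matrix.neg_mul, smul_mul_assoc, smul_neg, smul_smul, inv_mul_cancel₀ hlam', one_smul]
    abel

/-- **The residual invariance p.329 tl.29–32, exactly:** «even after imposing it there remains a subgroup of the gauge
group which acts still on the configurations satisfying (II.7), namely the gauge transformations independent of x₀» — for
invertible `g(x)` and an axial configuration (`A₀ = 0`), `A^g` is again axial at the point iff `∂₀g(x) = 0`.
[cite: MagnenRivasseauSeneor1993, §II.A (II.7) p.329 tl.20, tl.29–32] -/
theorem axial_preserved_iff_static (lam : ℝ) (hlam : lam ≠ 0) {g : Matrix (Fin 2) (Fin 2) ℂ} (hg : IsUnit g.det)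
    (dg : Matrix (Fin 2) (Fin 2) ℂ) : temporalComp lam g dg 0 = 0 ↔ dg = 0 := by
  rw [temporalComp_eq_zero_iff lam hlam hg]
  simp

/-- PRECISION (w): (II.8) PRINTS «g = P exp(− ∫ A_μ dx^μ)» WITHOUT the coupling; with (II.4) as printed the required
equation is `∂₀g = −λgA₀`. Literally (`∂₀g = −gA₀`) one gets `(A^g)₀ = (1 − λ⁻¹)·gA₀g⁻¹`, zero only for `λ = 1` or
`A₀ = 0` — the factor `λ` belongs in the exponent (as in `g = e^{λγ}`, tl.9). Recorded, not adjudicated.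
[cite: MagnenRivasseauSeneor1993, §II.A (II.4) p.329 tl.4–5, (II.8) tl.24–26] -/
theorem temporalComp_literal (lam : ℝ) (g A0 : Matrix (Fin 2) (Fin 2) ℂ) :
    temporalComp lam g (-(g * A0)) A0 = (1 - ((lam : ℂ)⁻¹)) • (g * A0 * g⁻¹) := by
  simp only [temporalComp, Matrix.neg_mul, smul_neg, sub_smul, one_smul]
  abel

/-- Entrywise product rule for matrix-valued functions of `x⁰` (READING (E)): if `g` and `U` are entrywise differentiable
with derivatives `g′`, `U′`, then so is `gU`, with derivative `g′U + gU′` (private plumbing). [folklore] -/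
private theorem hasDerivAt_mul_entry (g g' U U' : ℝ → Matrix (Fin 2) (Fin 2) ℂ) (s : ℝ)
    (hg : ∀ (i j : Fin 2), HasDerivAt (fun s => g s i j) (g' s i j) s)
    (hU : ∀ (i j : Fin 2), HasDerivAt (fun s => U s i j) (U' s i j) s) (i j : Fin 2) :
    HasDerivAt (fun s => (g s * U s) i j) ((g' s * U s + g s * U' s) i j) s := by
  have hsum0 := HasDerivAt.sum (u := Finset.univ) fun k _ => (hg i k).mul (hU k j)
  have e : (∑ k ∈ (Finset.univ : Finset (Fin 2)), ((fun s => g s i k) * fun s => U s k j))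
      = fun s => (g s * U s) i j := by
    funext s
    simp [Finset.sum_apply, Matrix.mul_apply]
  rw [e] at hsum0
  have e2 : ∑ k, (g' s i k * U s k j + g s i k * U' s k j) = (g' s * U s + g s * U' s) i j := by
    simp [Matrix.mul_apply, Matrix.add_apply, Finset.sum_add_distrib]
  rw [e2] at hsum0
  exact hsum0

/-- **Uniqueness of the (II.8) transformation along a temporal line (general `x⁰`-dependent `A₀`).** READING (ADJ): let
`U` be the INVERSE temporal transport — the solution of `∂₀U = λA₀U`, `U(0) = 1` (a path-ordered exponential with the
opposite ordering; its existence for continuous `A₀` is standard linear ODE theory and enters here as the datum `U`).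
Then EVERY solution `g` of the axial-gauge equation `∂₀g = −λgA₀` (⟺ `(A^g)₀ = 0`, `temporalComp_eq_zero_iff`)
satisfies `g(t)·U(t) = g(0)` for all `t`: the entries of `gU` have zero derivative. So the transformation realising (II.7)
is unique up to the left factor `g(0)` — it IS (II.8) up to an `x⁰`-independent transformation (tl.29–32).
[cite: MagnenRivasseauSeneor1993, §II.A (II.7)–(II.8) p.329 tl.19–32] -/
theorem solution_mul_invTransport_eq (lam : ℝ) (A0 g g' U U' : ℝ → Matrix (Fin 2) (Fin 2) ℂ)
    (hg : ∀ t (i j : Fin 2), HasDerivAt (fun s => g s i j) (g' t i j) t)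
    (hgeq : ∀ t, g' t = -((lam : ℂ) • (g t * A0 t)))
    (hU : ∀ t (i j : Fin 2), HasDerivAt (fun s => U s i j) (U' t i j) t)
    (hUeq : ∀ t, U' t = (lam : ℂ) • (A0 t * U t)) (hU0 : U 0 = 1) (t : ℝ) :
    g t * U t = g 0 := by
  -- each entry of g·U has zero derivative
  have hF : ∀ (i j : Fin 2) (s : ℝ), HasDerivAt (fun s => (g s * U s) i j) 0 s := by
    intro i j s
    have hm : g' s * U s + g s * U' s = 0 := by
      rw [hgeq s, hUeq s, neg_mul, smul_mul_assoc, mul_smul_comm, mul_assoc, neg_add_cancel]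
    have h := hasDerivAt_mul_entry g g' U U' s (hg s) (hU s) i j
    rw [hm] at h
    simpa using h
  ext i j
  have hdiff : Differentiable ℝ (fun s => (g s * U s) i j) := fun s => (hF i j s).differentiableAt
  have h := is_const_of_deriv_eq_zero hdiff (fun s => (hF i j s).deriv) t 0
  rw [h, hU0, mul_one]

/-- **The general form of the torus caveat (precision (u)):** if a configuration admits an `x⁰`-PERIODIC (period `T`)
gauge transformation `g`, invertible at `x⁰ = 0`, solving the axial-gauge equation along the temporal circle, then the
inverse temporal transport closes up: `U(T) = 1` — the temporal holonomy is trivial. (For `A₀ ≡ a·t₃` the transport is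
explicit and `U(T) = 1 ⟺ λaT/(4π) ∈ ℤ`: `transport_periodic_iff`, `holonomy_trivial_of_periodic_solution` below.)
[cite: MagnenRivasseauSeneor1993, §II.A p.328 tl.10–12, (II.7)–(II.8) p.329 tl.19–28] -/
theorem invTransport_closes_of_periodic (lam : ℝ) (T : ℝ) (A0 g g' U U' : ℝ → Matrix (Fin 2) (Fin 2) ℂ)
    (hg : ∀ t (i j : Fin 2), HasDerivAt (fun s => g s i j) (g' t i j) t)
    (hgeq : ∀ t, g' t = -((lam : ℂ) • (g t * A0 t)))
    (hU : ∀ t (i j : Fin 2), HasDerivAt (fun s => U s i j) (U' t i j) t)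
    (hUeq : ∀ t, U' t = (lam : ℂ) • (A0 t * U t)) (hU0 : U 0 = 1)
    (hinv : IsUnit (g 0).det) (hper : g T = g 0) : U T = 1 := by
  have h := solution_mul_invTransport_eq lam A0 g g' U U' hg hgeq hU hUeq hU0 T
  rw [hper] at h
  have h2 := congrArg (fun M => (g 0)⁻¹ * M) h
  simpa [← mul_assoc, Matrix.nonsing_inv_mul _ hinv] using h2

/-- **Gauge covariance of the temporal transport.** For ANY entrywise-differentiable, pointwise-invertible `h` (a gauge
transformation along the temporal line, not necessarily axialising) and the inverse transport `U` of `A₀` (READING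
(ADJ)), the conjugated-and-translated `Ũ(t) = h(t)U(t)h(0)⁻¹` solves the inverse-transport equation of the TRANSFORMED
time component `(A^h)₀ = hA₀h⁻¹ + λ⁻¹∂₀h·h⁻¹` (II.4): `∂₀Ũ = λ(A^h)₀Ũ`.
[cite: MagnenRivasseauSeneor1993, §II.A (II.4) p.329 tl.4–5, (II.8) tl.24–28] -/
theorem invTransport_gauge_covariant (lam : ℝ) (hlam : lam ≠ 0) (A0 h h' U U' : ℝ → Matrix (Fin 2) (Fin 2) ℂ)
    (hh : ∀ t (i j : Fin 2), HasDerivAt (fun s => h s i j) (h' t i j) t) (hhinv : ∀ t, IsUnit (h t).det)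
    (hU : ∀ t (i j : Fin 2), HasDerivAt (fun s => U s i j) (U' t i j) t)
    (hUeq : ∀ t, U' t = (lam : ℂ) • (A0 t * U t)) (t : ℝ) (i j : Fin 2) :
    HasDerivAt (fun s => (h s * U s * (h 0)⁻¹) i j)
      (((lam : ℂ) • (temporalComp lam (h t) (h' t) (A0 t) * (h t * U t * (h 0)⁻¹))) i j) t := by
  have hlam' : (lam : ℂ) ≠ 0 := by exact_mod_cast hlam
  have h1 : ∀ i j, HasDerivAt (fun s => (h s * U s) i j) ((h' t * U t + h t * U' t) i j) t :=
    hasDerivAt_mul_entry h h' U U' t (hh t) (hU t)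
  have h2 := hasDerivAt_mul_entry (fun s => h s * U s) (fun s => h' s * U s + h s * U' s) (fun _ => (h 0)⁻¹)
    (fun _ => 0) t h1 (fun i j => hasDerivAt_const t ((h 0)⁻¹ i j)) i j
  have key : (h' t * U t + h t * U' t) * (h 0)⁻¹ + h t * U t * 0
      = (lam : ℂ) • (temporalComp lam (h t) (h' t) (A0 t) * (h t * U t * (h 0)⁻¹)) := by
    simp only [temporalComp, hUeq t, Matrix.mul_zero, add_zero, add_mul, smul_add, smul_mul_assoc, mul_smul_comm,
      smul_smul, mul_inv_cancel₀ hlam', one_smul, mul_assoc, Matrix.nonsing_inv_mul_cancel_left _ _ (hhinv t)]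
    abel
  exact h2.congr_deriv (by rw [key])

/-- … with the right initial value: `Ũ(0) = h(0)U(0)h(0)⁻¹ = 1`. [cite: MagnenRivasseauSeneor1993, §II.A (II.8) p.329 tl.24–28] -/
theorem invTransport_gauge_initial (h U : ℝ → Matrix (Fin 2) (Fin 2) ℂ) (h0 : IsUnit (h 0).det) (hU0 : U 0 = 1) :
    h 0 * U 0 * (h 0)⁻¹ = 1 := by
  rw [hU0, mul_one, Matrix.mul_nonsing_inv _ h0]

/-- **The temporal holonomy is gauge-COVARIANT (conjugated), hence its triviality is gauge-INVARIANT:** for a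
`T`-PERIODIC `h`, `Ũ(T) = h(T)U(T)h(0)⁻¹ = h(0)U(T)h(0)⁻¹`, and `h(0)U(T)h(0)⁻¹ = 1 ⟺ U(T) = 1`. So the obstruction of
precision (u) cannot be removed by any periodic gauge transformation (p.328 tl.10–12), consistently with
`invTransport_closes_of_periodic`. [cite: MagnenRivasseauSeneor1993, §II.A p.328 tl.10–12, (II.7)–(II.8) p.329 tl.19–28] -/
theorem holonomy_trivial_iff_conj (h U : ℝ → Matrix (Fin 2) (Fin 2) ℂ) (T : ℝ) (h0 : IsUnit (h 0).det)
    (hper : h T = h 0) : h T * U T * (h 0)⁻¹ = 1 ↔ U T = 1 := by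
  rw [hper]
  constructor
  · intro hc
    have h2 := congrArg (fun M => (h 0)⁻¹ * M * h 0) hc
    simpa [mul_assoc, Matrix.nonsing_inv_mul _ h0, Matrix.nonsing_inv_mul_cancel_left _ _ h0] using h2
  · intro hU
    rw [hU, mul_one, Matrix.mul_nonsing_inv _ h0]

/-- The abelian witness direction: `A₀ = a·t₃` (printed `t₃ = iσ₃/2`), i.e. the diagonal matrix `diag(ia/2, −ia/2)`.
[cite: MagnenRivasseauSeneor1993, §II.A p.328 tl.26, (II.7) p.329] -/
def cartan (a : ℝ) : Matrix (Fin 2) (Fin 2) ℂ := !![(a : ℂ) * I / 2, 0; 0, -((a : ℂ) * I / 2)]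

/-- `cartan a = a·t₃` for the printed generator. [cite: MagnenRivasseauSeneor1993, §II.A p.328 tl.26] -/
theorem cartan_eq_smul_tgen (a : ℝ) : cartan a = (a : ℂ) • tgen 2 := by
  ext i j
  fin_cases i <;> fin_cases j <;> simp [cartan, tgen, pauli] <;> ring

/-- The phase `θ(t) = (λa/2)·t·i`. [cite: MagnenRivasseauSeneor1993, §II.A (II.8) p.329] -/
def phase (lam a t : ℝ) : ℂ := ((lam * a / 2 * t : ℝ) : ℂ) * I

/-- **(II.8) for the witness, explicitly:** `g(t) = P exp(−λ∫₀ᵗ A₀) = e^{−λ t a t₃} = diag(e^{−iλat/2}, e^{iλat/2})`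
(the generator is `t`-independent, so the path-ordered exponential is the plain exponential).
[cite: MagnenRivasseauSeneor1993, §II.A (II.8) p.329 tl.24–28] -/
def transport (lam a t : ℝ) : Matrix (Fin 2) (Fin 2) ℂ :=
  !![Complex.exp (-phase lam a t), 0; 0, Complex.exp (phase lam a t)]

/-- `g(0) = 1` (the path starts at the hyperplane `x₀ = 0`, p.329 tl.27–28). [cite: MagnenRivasseauSeneor1993, §II.A (II.8) p.329] -/
theorem transport_zero (lam a : ℝ) : transport lam a 0 = 1 := by
  ext i j
  fin_cases i <;> fin_cases j <;> simp [transport, phase]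

/-- The derivative of the phase: `θ′ = (λa/2)·i`. [cite: MagnenRivasseauSeneor1993, §II.A (II.8) p.329] -/
theorem hasDerivAt_phase (lam a t : ℝ) : HasDerivAt (fun s => phase lam a s) (((lam * a / 2 : ℝ) : ℂ) * I) t := by
  have h : HasDerivAt (fun s : ℝ => lam * a / 2 * s) (lam * a / 2 * 1) t := (hasDerivAt_id t).const_mul _
  have h2 := (h.ofReal_comp).mul_const I
  simpa [phase] using h2

/-- **`transport` solves the (II.8) equation `∂₀g = −λ g A₀`** for `A₀ = a·t₃`, entrywise (READING (E): a
differentiable matrix-valued function of `x⁰` = entrywise differentiable).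
[cite: MagnenRivasseauSeneor1993, §II.A (II.7)–(II.8) p.329 tl.19–28] -/
theorem hasDerivAt_transport (lam a t : ℝ) (i j : Fin 2) :
    HasDerivAt (fun s => transport lam a s i j) ((-((lam : ℂ) • (transport lam a t * cartan a))) i j) t := by
  have hθ := hasDerivAt_phase lam a t
  fin_cases i <;> fin_cases j
  · have e : (-((lam : ℂ) • (transport lam a t * cartan a))) 0 0
        = Complex.exp (-phase lam a t) * -(((lam * a / 2 : ℝ) : ℂ) * I) := by
      simp [transport, cartan]
      ring
    have hf : (fun s => transport lam a s 0 0) = fun s => Complex.exp (-phase lam a s) := by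
      funext s
      simp [transport]
    simp only [Fin.zero_eta, Fin.isValue]
    rw [hf, e]
    exact hθ.neg.cexp
  · have e : (-((lam : ℂ) • (transport lam a t * cartan a))) 0 1 = 0 := by
      simp [transport, cartan]
    simp only [Fin.zero_eta, Fin.mk_one, Fin.isValue]
    rw [e]
    simpa [transport] using hasDerivAt_const t (0 : ℂ)
  · have e : (-((lam : ℂ) • (transport lam a t * cartan a))) 1 0 = 0 := by
      simp [transport, cartan]
    simp only [Fin.zero_eta, Fin.mk_one, Fin.isValue]
    rw [e]
    simpa [transport] using hasDerivAt_const t (0 : ℂ)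
  · have e : (-((lam : ℂ) • (transport lam a t * cartan a))) 1 1
        = Complex.exp (phase lam a t) * (((lam * a / 2 : ℝ) : ℂ) * I) := by
      simp [transport, cartan]
      ring
    have hf : (fun s => transport lam a s 1 1) = fun s => Complex.exp (phase lam a s) := by
      funext s
      simp [transport]
    simp only [Fin.mk_one, Fin.isValue]
    rw [hf, e]
    exact hθ.cexp

/-- `det g(t) = 1`. [cite: MagnenRivasseauSeneor1993, §II.A p.328 tl.9–11 («G», SU(2)), (II.8) p.329] -/
theorem det_transport (lam a t : ℝ) : (transport lam a t).det = 1 := by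
  rw [transport, Matrix.det_fin_two_of, ← Complex.exp_add]
  simp

/-- `g(t) g(t)† = 1` (unitarity: the phases are unimodular for real `λ, a, t`).
[cite: MagnenRivasseauSeneor1993, §II.A p.328 tl.9–11, (II.8) p.329] -/
theorem transport_mul_star (lam a t : ℝ) : transport lam a t * star (transport lam a t) = 1 := by
  have hc : (starRingEnd ℂ) (phase lam a t) = -phase lam a t := by
    rw [phase, map_mul, Complex.conj_ofReal, Complex.conj_I]
    ring
  ext i j
  fin_cases i <;> fin_cases j <;>
    simp [transport, Matrix.mul_apply, Fin.sum_univ_two, Matrix.star_apply, ← Complex.exp_conj, hc,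
      ← Complex.exp_add]

/-- **The witness transformation is a genuine `SU(2)`-valued gauge transformation** at every `x⁰`.
[cite: MagnenRivasseauSeneor1993, §II.A p.328 tl.9–11, (II.8) p.329] -/
theorem transport_mem_specialUnitaryGroup (lam a t : ℝ) :
    transport lam a t ∈ Matrix.specialUnitaryGroup (Fin 2) ℂ := by
  rw [Matrix.mem_specialUnitaryGroup_iff, Matrix.mem_unitaryGroup_iff]
  exact ⟨transport_mul_star lam a t, det_transport lam a t⟩

/-- … hence it DOES reach the axial gauge along the line: `(A^g)₀ = 0` for `A₀ = a·t₃`, at every `x⁰` — the print's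
«for any field configuration A there is a gauge transformation such that A^g in (II.4) satisfies it» holds along each
temporal LINE. [cite: MagnenRivasseauSeneor1993, §II.A (II.7)–(II.8) p.329 tl.21–28] -/
theorem temporalComp_transport (lam a t : ℝ) (hlam : lam ≠ 0) :
    temporalComp lam (transport lam a t) (-((lam : ℂ) • (transport lam a t * cartan a))) (cartan a) = 0 := by
  have hdet : IsUnit (transport lam a t).det := by rw [det_transport]; exact isUnit_one
  exact (temporalComp_eq_zero_iff lam hlam hdet _ _).2 rfl

/-- **Periodicity of (II.8) = triviality of the temporal holonomy.** On the torus (period `T` in `x⁰`) the witness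
transformation is `T`-periodic iff `e^{−λTa·t₃} = 1`, i.e. iff `λaT/(4π) ∈ ℤ`.
[cite: MagnenRivasseauSeneor1993, §II.A p.328 tl.6–11 (torus, periodic gauge transformations), (II.8) p.329] -/
theorem transport_periodic_iff (lam a T : ℝ) :
    (∀ t, transport lam a (t + T) = transport lam a t) ↔ ∃ n : ℤ, lam * a * T = 4 * Real.pi * n := by
  constructor
  · intro h
    have h0 := congrArg (fun M : Matrix (Fin 2) (Fin 2) ℂ => M 1 1) (h 0)
    simp only [transport, zero_add, Matrix.of_apply, Matrix.cons_val', Matrix.cons_val_one,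
      Matrix.cons_val_fin_one] at h0
    rw [show phase lam a 0 = 0 by simp [phase], Complex.exp_zero, Complex.exp_eq_one_iff] at h0
    obtain ⟨n, hn⟩ := h0
    refine ⟨n, ?_⟩
    have h1 := congrArg Complex.im hn
    simp [phase] at h1
    nlinarith [h1, Real.pi_pos]
  · rintro ⟨n, hn⟩ t
    have key : Complex.exp (phase lam a (t + T)) = Complex.exp (phase lam a t) := by
      have : phase lam a (t + T) = phase lam a t + (n : ℂ) * (2 * Real.pi * I) := by
        simp only [phase]
        push_cast
        have : (lam : ℂ) * a / 2 * T = 2 * Real.pi * n := by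
          have := congrArg (fun r : ℝ => (r : ℂ) / 2) hn
          push_cast at this
          linear_combination this
        linear_combination this * I
      rw [this, Complex.exp_add, Complex.exp_int_mul_two_pi_mul_I, mul_one]
    have key' : Complex.exp (-phase lam a (t + T)) = Complex.exp (-phase lam a t) := by
      rw [Complex.exp_neg, Complex.exp_neg, key]
    ext i j
    fin_cases i <;> fin_cases j <;> simp [transport, key, key']

/-- **THE TORUS CAVEAT (precision (u)), kernel theorem.** Let `g : ℝ → GL₂(ℂ) ⊇ SU(2)` be entrywise differentiable
along a temporal circle of length `T`, invertible at `x⁰ = 0`, `T`-periodic, and solve the axial-gauge equation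
`∂₀g = −λ g A₀` for `A₀ = a·t₃`. Then the temporal holonomy is trivial: `λaT/(4π) ∈ ℤ`. (Proof: each entry of the first
column of `g` times `e^{iλat/2}` has zero derivative, hence is constant; periodicity and invertibility force
`e^{iλaT/2} = 1`.) [cite: MagnenRivasseauSeneor1993, §II.A p.328 tl.6–11, (II.7)–(II.8) p.329 tl.19–28] -/
theorem holonomy_trivial_of_periodic_solution (lam a T : ℝ) (g g' : ℝ → Matrix (Fin 2) (Fin 2) ℂ)
    (hd : ∀ t (i j : Fin 2), HasDerivAt (fun s => g s i j) (g' t i j) t)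
    (hode : ∀ t, g' t = -((lam : ℂ) • (g t * cartan a)))
    (hinv : IsUnit (g 0).det) (hper : g T = g 0) :
    ∃ n : ℤ, lam * a * T = 4 * Real.pi * n := by
  -- the first column: f_i(t) = g(t)_{i0} satisfies f' = −(λa/2)i·f
  have hcol : ∀ (i : Fin 2) (t : ℝ),
      HasDerivAt (fun s => g s i 0) (-(((lam * a / 2 : ℝ) : ℂ) * I) * g t i 0) t := by
    intro i t
    have h := hd t i 0
    rw [hode t] at h
    convert h using 1
    simp [cartan, Matrix.mul_apply, Fin.sum_univ_two]
    ring
  -- so f_i(t)·e^{θ(t)} is constant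
  have hconst : ∀ (i : Fin 2) (t : ℝ), g t i 0 * Complex.exp (phase lam a t) = g 0 i 0 := by
    intro i t
    have hF : ∀ s, HasDerivAt (fun s => g s i 0 * Complex.exp (phase lam a s)) 0 s := by
      intro s
      exact ((hcol i s).mul ((hasDerivAt_phase lam a s).cexp)).congr_deriv (by ring)
    have hdiff : Differentiable ℝ (fun s => g s i 0 * Complex.exp (phase lam a s)) :=
      fun s => (hF s).differentiableAt
    have h := is_const_of_deriv_eq_zero hdiff (fun s => (hF s).deriv) t 0
    simpa [phase] using h
  -- periodicity: f_i(0)·(e^{θ(T)} − 1) = 0 for both i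
  have hT : ∀ i : Fin 2, g 0 i 0 * (Complex.exp (phase lam a T) - 1) = 0 := by
    intro i
    have h := hconst i T
    rw [hper] at h
    linear_combination h
  -- invertibility at 0: the first column of g(0) is not zero
  have hne : g 0 0 0 ≠ 0 ∨ g 0 1 0 ≠ 0 := by
    by_contra hcon
    simp only [not_or, not_not] at hcon
    have hdet : (g 0).det = 0 := by
      rw [Matrix.det_fin_two, hcon.1, hcon.2]
      ring
    exact (hinv.ne_zero) hdet
  have hexp : Complex.exp (phase lam a T) = 1 := by
    rcases hne with h | h
    · have := hT 0
      rcases mul_eq_zero.1 this with h0 | h0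
      · exact absurd h0 h
      · exact sub_eq_zero.1 h0
    · have := hT 1
      rcases mul_eq_zero.1 this with h0 | h0
      · exact absurd h0 h
      · exact sub_eq_zero.1 h0
  obtain ⟨n, hn⟩ := Complex.exp_eq_one_iff.1 hexp
  refine ⟨n, ?_⟩
  have h1 := congrArg Complex.im hn
  simp [phase] at h1
  nlinarith [h1, Real.pi_pos]

/-- **Corollary (the printed sentence p.329 tl.21–23 on the torus of p.328 tl.6–11): NOT every configuration is gauge
equivalent to one with `A₀ = 0`.** For `A₀ ≡ a·t₃` with `λaT/(4π) ∉ ℤ` there is NO `x⁰`-periodic (period `T`),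
`x⁰`-differentiable, invertible-matrix-valued `g` — a fortiori no periodic `SU(2)`-valued one — with `(A^g)₀ = 0` along
the temporal circle. (Contrast `temporalComp_transport`: along the LINE it exists; `transport_periodic_iff`: it closes up
iff the holonomy is trivial.) The axial ansatz (II.9)–(II.10) with `δ(A₀)` on `T⁴` therefore reaches only gauge orbits of
trivial temporal holonomy; MRS START from that postulated ansatz («Our starting point is the Yang-Mills theory in the
axial gauge», tl.19), so no typed statement of the tree moves. [cite: MagnenRivasseauSeneor1993, §II.A p.328 tl.6–11, (II.7)–(II.8) p.329 tl.19–28] -/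
theorem no_periodic_gauge_to_axial (lam a T : ℝ) (hlam : lam ≠ 0) (hna : ∀ n : ℤ, lam * a * T ≠ 4 * Real.pi * n) :
    ¬ ∃ g g' : ℝ → Matrix (Fin 2) (Fin 2) ℂ,
        (∀ t (i j : Fin 2), HasDerivAt (fun s => g s i j) (g' t i j) t) ∧ (∀ t, IsUnit (g t).det) ∧
        (∀ t, g (t + T) = g t) ∧ ∀ t, temporalComp lam (g t) (g' t) (cartan a) = 0 := by
  rintro ⟨g, g', hd, hinv, hper, hax⟩
  have hode : ∀ t, g' t = -((lam : ℂ) • (g t * cartan a)) :=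
    fun t => (temporalComp_eq_zero_iff lam hlam (hinv t) _ _).1 (hax t)
  obtain ⟨n, hn⟩ := holonomy_trivial_of_periodic_solution lam a T g g' hd hode (hinv 0) (by simpa using hper 0)
  exact hna n hn

/-- `g(T) = 1` iff the temporal holonomy is trivial: `transport λ a T = 1 ⟺ λaT/(4π) ∈ ℤ`.
[cite: MagnenRivasseauSeneor1993, §II.A p.328 tl.10–12, (II.8) p.329] -/
theorem transport_eq_one_iff (lam a T : ℝ) :
    transport lam a T = 1 ↔ ∃ n : ℤ, lam * a * T = 4 * Real.pi * n := by
  rw [← transport_periodic_iff]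
  constructor
  · intro h t
    have key : ∀ s, transport lam a (s + T) = transport lam a s * transport lam a T := by
      intro s
      ext i j
      fin_cases i <;> fin_cases j <;>
        simp [transport, phase, Matrix.mul_apply, Fin.sum_univ_two, ← Complex.exp_add] <;> ring_nf
    rw [key, h, mul_one]
  · intro h
    simpa [transport_zero] using h 0

/-- The diagonal witness matrices commute: `A₀ · transport = transport · A₀`.
[cite: MagnenRivasseauSeneor1993, §II.A (II.8) p.329] -/
theorem cartan_mul_transport (lam a b t : ℝ) : cartan a * transport lam b t = transport lam b t * cartan a := by
  ext i j
  fin_cases i <;> fin_cases j <;> simp [transport, cartan, Matrix.mul_apply, Fin.sum_univ_two] <;> ring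

/-- `cartan (−a) = −cartan a`. [cite: MagnenRivasseauSeneor1993, §II.A p.328 tl.26] -/
theorem cartan_neg (a : ℝ) : cartan (-a) = -cartan a := by
  ext i j
  fin_cases i <;> fin_cases j <;> simp [cartan] <;> ring

/-- **The explicit inverse transport of the witness** (READING (ADJ) instantiated): `U(t) = transport λ (−a) t =
diag(e^{iλat/2}, e^{−iλat/2})` solves `∂₀U = λA₀U` for `A₀ = a·t₃`, with `U(0) = 1` (`transport_zero`).
[cite: MagnenRivasseauSeneor1993, §II.A (II.8) p.329 tl.24–28] -/
theorem hasDerivAt_invTransport (lam a t : ℝ) (i j : Fin 2) :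
    HasDerivAt (fun s => transport lam (-a) s i j) (((lam : ℂ) • (cartan a * transport lam (-a) t)) i j) t := by
  have h := hasDerivAt_transport lam (-a) t i j
  rw [cartan_neg, Matrix.mul_neg, smul_neg, neg_neg, ← cartan_mul_transport] at h
  exact h

/-- **The general closure theorem reproduces the explicit dichotomy:** feeding the witness's inverse transport into
`invTransport_closes_of_periodic` gives `holonomy_trivial_of_periodic_solution` again (consistency of READING (ADJ) with
the closed-form computation). [cite: MagnenRivasseauSeneor1993, §II.A p.328 tl.10–12, (II.7)–(II.8) p.329 tl.19–28] -/
theorem holonomy_trivial_of_periodic_solution' (lam a T : ℝ) (g g' : ℝ → Matrix (Fin 2) (Fin 2) ℂ)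
    (hd : ∀ t (i j : Fin 2), HasDerivAt (fun s => g s i j) (g' t i j) t)
    (hode : ∀ t, g' t = -((lam : ℂ) • (g t * cartan a)))
    (hinv : IsUnit (g 0).det) (hper : g T = g 0) :
    ∃ n : ℤ, lam * a * T = 4 * Real.pi * n := by
  have hU := invTransport_closes_of_periodic lam T (fun _ => cartan a) g g' (fun s => transport lam (-a) s)
    (fun s => (lam : ℂ) • (cartan a * transport lam (-a) s)) hd hode (fun t i j => hasDerivAt_invTransport lam a t i j)
    (fun _ => rfl) (transport_zero lam (-a)) hinv hper
  obtain ⟨n, hn⟩ := (transport_eq_one_iff lam (-a) T).1 hU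
  exact ⟨-n, by push_cast; linarith⟩

/-- **The converse half of the dichotomy for the witness family:** when the temporal holonomy IS trivial
(`λaT/(4π) ∈ ℤ`), the explicit `SU(2)`-valued (II.8) transformation is `T`-periodic, differentiable, invertible and
reaches the axial gauge everywhere along the circle. [cite: MagnenRivasseauSeneor1993, §II.A p.328 tl.6–11, (II.7)–(II.8) p.329 tl.19–28] -/
theorem exists_periodic_gauge_to_axial (lam a T : ℝ) (hlam : lam ≠ 0) (hn : ∃ n : ℤ, lam * a * T = 4 * Real.pi * n) :
    ∃ g g' : ℝ → Matrix (Fin 2) (Fin 2) ℂ,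
        (∀ t (i j : Fin 2), HasDerivAt (fun s => g s i j) (g' t i j) t) ∧ (∀ t, IsUnit (g t).det) ∧
        (∀ t, g (t + T) = g t) ∧ (∀ t, g t ∈ Matrix.specialUnitaryGroup (Fin 2) ℂ) ∧
        ∀ t, temporalComp lam (g t) (g' t) (cartan a) = 0 := by
  refine ⟨fun t => transport lam a t, fun t => -((lam : ℂ) • (transport lam a t * cartan a)),
    fun t i j => hasDerivAt_transport lam a t i j, fun t => ?_, (transport_periodic_iff lam a T).2 hn,
    fun t => transport_mem_specialUnitaryGroup lam a t, fun t => temporalComp_transport lam a t hlam⟩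
  rw [det_transport]
  exact isUnit_one

/-- Non-vacuity of the hypothesis: e.g. `λ = a = 1`, `T = 2π` (so `λaT/(4π) = 1/2 ∉ ℤ`).
[cite: MagnenRivasseauSeneor1993, §II.A p.328 tl.6–11, (II.7)–(II.8) p.329] -/
theorem hna_example : ∀ n : ℤ, (1 : ℝ) * 1 * (2 * Real.pi) ≠ 4 * Real.pi * n := by
  intro n h
  have h1 : (2 : ℝ) * n = 1 := by nlinarith [Real.pi_pos, h]
  have h2 : (2 : ℤ) * n = 1 := by exact_mod_cast h1
  omega

end AxialGauge

section Torus

open Su2Conventions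

/-- Position space of the torus picture: `x = (x⁰, x¹, x², x³) ∈ ℝ⁴`, fields and gauge transformations `T`-periodic in
`x⁰` (p.328 tl.6–11, period lattice). The temporal line through `x` : `s ↦ x + s·e₀`.
[cite: MagnenRivasseauSeneor1993, §II.A p.328 tl.6–11] -/
def timeShift (x : Fin 4 → ℝ) (s : ℝ) : Fin 4 → ℝ := x + s • Pi.single 0 1

/-- `timeShift x 0 = x`. [cite: MagnenRivasseauSeneor1993, §II.A p.328 tl.6–11] -/
theorem timeShift_zero (x : Fin 4 → ℝ) : timeShift x 0 = x := by
  simp [timeShift]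

/-- `timeShift 0 s + T·e₀ = timeShift 0 (s + T)`. [cite: MagnenRivasseauSeneor1993, §II.A p.328 tl.6–11] -/
theorem timeShift_add (s T : ℝ) : timeShift 0 s + T • Pi.single 0 1 = timeShift 0 (s + T) := by
  simp [timeShift, add_smul]

/-- **Precision (u) on `T⁴`, packaged.** A configuration on the torus whose time component is the constant
`A₀ ≡ a·t₃` with `λaT/(4π) ∉ ℤ` (spatial components arbitrary) admits NO gauge transformation `g : ℝ⁴ → GL₂(ℂ)`
that is `T`-periodic in `x⁰`, differentiable along `x⁰` (entrywise, derivative `dg0`), and brings it to the axial gauge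
(II.7) everywhere. (`A₀` constant is chosen for transparency; the obstruction is the temporal holonomy class — periodic
gauge transformations conjugate the holonomy, `invTransport_gauge_covariant`/`holonomy_trivial_iff_conj`; for this
family the dichotomy is `transport_periodic_iff`, `exists_periodic_gauge_to_axial`, and the present negative statement.) [cite: MagnenRivasseauSeneor1993, §II.A p.328 tl.6–11, (II.7)–(II.8) p.329 tl.19–28] -/
theorem no_periodic_gauge_to_axial_torus (lam a T : ℝ) (hlam : lam ≠ 0)
    (hna : ∀ n : ℤ, lam * a * T ≠ 4 * Real.pi * n) :
    ¬ ∃ g dg0 : (Fin 4 → ℝ) → Matrix (Fin 2) (Fin 2) ℂ,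
        (∀ x t (i j : Fin 2), HasDerivAt (fun s => g (timeShift x s) i j) (dg0 (timeShift x t) i j) t) ∧
        (∀ x, IsUnit (g x).det) ∧ (∀ x, g (x + T • Pi.single 0 1) = g x) ∧
        ∀ x, temporalComp lam (g x) (dg0 x) (cartan a) = 0 := by
  rintro ⟨g, dg0, hd, hinv, hper, hax⟩
  apply no_periodic_gauge_to_axial lam a T hlam hna
  refine ⟨fun s => g (timeShift 0 s), fun s => dg0 (timeShift 0 s), fun t i j => hd 0 t i j,
    fun t => hinv _, fun t => ?_, fun t => hax _⟩
  show g (timeShift 0 (t + T)) = g (timeShift 0 t)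
  rw [← timeShift_add, hper]

end Torus

/-!
# v1.1/v1.2 APPEND (gen 9), namespace `FiniteGauge.PathOrdered`: (II.8) EXISTS — the path-ordered exponential
# `g = P exp(−λ∫₀^{x⁰}A₀)` and the inverse temporal transport for EVERY continuous `A₀(x⁰)` (global Cauchy–Lipschitz),
# `SU(2)`-valued for `su(2)`-valued `A₀`; p.329 tl.21–23 PROVED along every temporal line; and on the torus the general
# dichotomy: a periodic axialising gauge transformation exists IFF the temporal holonomy is trivial

(Appended to this file rather than filed as the separate leaf `MRS93TemporalGaugeTransport.lean` announced on the cell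
bus, because the check farm had not built this module's olean on 2026-08-23; the content is unchanged. Everything of
v1 above is kept byte-for-byte. v1.2 = v1.1 with three quotations of p.329 tl.19–32 restored to the verbatim text of v1
(referee R8, cell bus [REF-G26-R8-FINITEGAUGE-V11-FAIL]); no Lean line changed.)

statement-level skeleton of published definitions with citation tags; bookkeeping proved; nothing here is a claim
about the Yang–Mills mass gap, about continuum Yang–Mills on `T⁴` without infrared cutoff, or about the Clay problem —
and nothing of Magnen–Rivasseau–Sénéor's analysis is asserted or formalised

**Citation header (reproduction of PUBLISHED work).** J. Magnen, V. Rivasseau, R. Sénéor, *Construction of YM₄ with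
an infrared cutoff*, Commun. Math. Phys. **155** (1993) 325–383 [MagnenRivasseauSeneor1993], Sect. II.A p.328 tl.6–18
(the torus, the periodic gauge group, `G = SU(2)`), p.329 tl.4–5 ((II.4)), tl.19–32 ((II.7), (II.8), the residual
group). Loci `p.NNN tl.nn` = journal page / text-layer line of the held scan
`paper:magnen1993-cmp155-mrs-ym4-infrared-cutoff` (PDF page = journal page − 324). Cell pub-balaban-gaps, track G3,
seat mrs-lit-1 (gen 9); companion prose `run/shared/lean/pub/pub-balaban-gaps/g3/MRS-AS-PRINTED.md` §2, §3 (a′), §5.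
Builds on v1 of this file above (gen 8: `FiniteGauge.temporalComp`, `temporalComp_eq_zero_iff`,
`solution_mul_invTransport_eq`, `invTransport_closes_of_periodic`, `cartan`, `transport`, `hasDerivAt_transport`,
`transport_eq_one_iff`) and on the tree's global Cauchy–Lipschitz theory `Literature.Analysis.ODE.EvolutionMap`
(`IsUniformlyLipschitzOn`, `evolutionMap`, `hasDerivAt_evolutionMap`; Teschl Cor. 2.6, Hartman Ch. II Thm 1.1 as cited
there).

**Why this append.** Gen 8 typed the algebraic content of (II.7)/(II.8) — `(A^g)₀ = 0 ⟺ ∂₀g = −λgA₀` — and proved the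
torus caveat (precision (u)) in two forms: a general closure theorem CONDITIONAL on a datum `U` («the INVERSE temporal
transport — the solution of ∂₀U = λA₀U, U(0) = 1 …; its existence for continuous A₀ is standard linear ODE theory and
enters here as the datum U», docstring of `solution_mul_invTransport_eq`) and an unconditional dichotomy for the explicit
abelian family `A₀ ≡ a·t₃` only; its successor list names «EXISTENCE of the inverse transport U for continuous
x⁰-dependent A₀ (linear ODE on [0,T]) … so that `invTransport_closes_of_periodic`/`invTransport_gauge_covariant` lose
their datum U». This append supplies it: for EVERY continuous `A₀ : ℝ → M₂(ℂ)` the inverse transport `U` and the (II.8)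
transformation `g` are CONSTRUCTED (evolution maps of the linear equations `∂₀U = λA₀U`, `∂₀g = −λgA₀`, global on `ℝ`
by the tree's Cauchy–Lipschitz theorem — a linear field with continuous coefficient is uniformly Lipschitz on compact
time sets), and everything gen 8 stated modulo `U` becomes unconditional: the printed sentence p.329 tl.21–23 holds
along every temporal LINE for every continuous non-abelian `x⁰`-dependent `A₀` (`temporalComp_gaugeToAxial`), the
transformation is unique up to the residual group (`solution_eq_mul_gaugeToAxial`), it is `SU(2)`-valued when `A₀`
is `su(2)`-valued (`gaugeToAxial_mem_specialUnitaryGroup`), and on the TORUS (periodic `A₀`) a periodic, everywhere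
invertible, axialising `g` exists IF AND ONLY IF `U(T) = 1` (`exists_periodic_gauge_to_axial_iff`) — gen 8's witness
family is recovered as the special case `A₀ ≡ a·t₃` (`gaugeToAxial_const_cartan`, `invTransport_const_cartan`,
`invTransport_const_cartan_eq_one_iff`).

**What the paper prints (verbatim, from the page images).**
* p.328 tl.10–12: *«in the case of the torus with the trivial SU(2) bundle, the gauge transformation are simply the
  functions x → g(x) from ℝ⁴ to G which are periodic with period lattice ℤ⁴.»*
* p.329 tl.4–5: *«A → A^g; (A^g)_μ = gA_μg⁻¹ + (1/λ)∂_μg·g⁻¹. (II.4)»*; tl.19–28 (verbatim, as in v1 above): *«Our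
  starting point is the Yang-Mills theory in the axial gauge. This gauge is defined by the condition A₀ = 0. (II.7) This
  is a gauge condition that can be imposed in the sense that for any field configuration A there is a gauge
  transformation such that A^g in (II.4) satisfies it; indeed we can take g = P exp(− ∫_{0,x⃗}^{x} A_μ dx^μ), (II.8) where
  the P means a path ordered exponential (limit of a Trotter product of exponentials along the path), and the path goes
  from {O, x⃗}, the point on the hyperplane x₀ = 0 to x, hence this path is parallel to the direction 0.»*; tl.29–32:
  *«Remark that such an axial gauge condition a priori is not complete, in the sense that even after imposing it there
  remains a subgroup of the gauge group which acts still on the configurations satisfying (II.7), namely the gauge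
  transformations independent of x₀, the "time coordinate." We do not fix this remaining invariance yet.»*

**What is typed here (definitions with bodies; everything else PROVED; zero `sorry`, zero named facts).**
* §1 PLUMBING: `Mat = M₂(ℂ)` with the ELEMENTWISE sup norm as a local instance (Mathlib `Matrix.normedAddCommGroup`/
  `Matrix.normedSpace` — the Pi norm, so that matrix-valued `HasDerivAt` is entrywise `HasDerivAt`, READING (E) of
  `…FiniteGaugeTransformations`, by `hasDerivAt_pi` twice); `‖BX‖ ≤ 2‖B‖‖X‖` (`norm_mul_le_two`); the linear fields
  `X ↦ λA₀(t)X` (`invTransportField`) and `X ↦ −λXA₀(t)` (`gaugeField`) are `IsUniformlyLipschitzOn … univ` for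
  continuous `A₀` (continuous in `t`; Lipschitz constant `2|λ| sup_C‖A₀‖` on each compact `C`).
* §2 THE OBJECTS: **`invTransport lam A0 t = U(t)`** and **`gaugeToAxial lam A0 t = g(t)`** := the evolution maps
  (`Literature.Analysis.ODE.evolutionMap`) of the two linear equations from `1` at `x⁰ = 0`; PROVED `U(0) = g(0) = 1`,
  `hasDerivAt_invTransport` (`∂₀U = λA₀U` on all of `ℝ`), `hasDerivAt_gaugeToAxial` (`∂₀g = −λgA₀`), entrywise forms.
* §3 **(II.8) REALISES (II.7) ALONG EVERY LINE**: `gaugeToAxial_mul_invTransport` (`g(t)U(t) = 1`, gen 8's identity with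
  both factors now constructed), `invTransport_mul_gaugeToAxial`, `isUnit_det_gaugeToAxial`, `gaugeToAxial_inv`
  (`g⁻¹ = U`), **`temporalComp_gaugeToAxial`** (`(A^g)₀ = 0` at every `x⁰`, for every continuous `A₀` and `λ ≠ 0` —
  p.329 tl.21–23 along the line), **`solution_eq_mul_gaugeToAxial`** (every solution of the axial-gauge equation is
  `g̃(0)·g` — unique up to the residual `x⁰`-independent factor, tl.29–32).
* §4 **`G = SU(2)`**: `gaugeToAxial_mul_conjTranspose` (`A₀ᴴ = −A₀ ⟹ ggᴴ = 1`: the entries of `ggᴴ` have zero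
  derivative), `det_gaugeToAxial` (`tr A₀ = 0 ⟹ det g = 1`: Liouville for `2 × 2`, `(det g)′ = −λ tr(A₀) det g`),
  **`gaugeToAxial_mem_specialUnitaryGroup`**.
* §5 **THE TORUS, IN GENERAL**: `gaugeToAxial_periodic` (`A₀` `T`-periodic and `U(T) = 1 ⟹ g` is `T`-periodic, by
  uniqueness: `s ↦ g(s+T)` solves the same equation), **`exists_periodic_gauge_to_axial_iff`**: for continuous
  `T`-periodic `A₀` and `λ ≠ 0`, (∃ `x⁰`-periodic, entrywise differentiable, everywhere invertible `g` with `(A^g)₀ = 0`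
  along the circle) ⟺ `U(T) = 1`; `exists_periodic_su2_gauge_to_axial` (then it may be taken `SU(2)`-valued).
* §5b `eq_invTransport` (uniqueness of `U`), **`invTransport_gaugeAct`** (gen 8's gauge covariance `U_{A^h} = hUh(0)⁻¹`
  now unconditional, for `h` entrywise `C¹` and everywhere invertible; `continuous_temporalComp`) and **`invTransport_gaugeAct_eq_one_iff`**
  (triviality of the temporal holonomy is invariant under periodic gauge transformations).
* §6 CONSISTENCY WITH GEN 8'S WITNESS FAMILY `A₀ ≡ a·t₃`: `gaugeToAxial_const_cartan` (`g = transport λ a`, gen 8's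
  explicit diagonal exponential, by uniqueness), `invTransport_const_cartan` (`U = transport λ (−a)`),
  `invTransport_const_cartan_eq_one_iff` (`U(T) = 1 ⟺ λaT/(4π) ∈ ℤ`): the general dichotomy of §5 specialises to
  gen 8's `no_periodic_gauge_to_axial` / `exists_periodic_gauge_to_axial`.

**Readings (declared).** (E) matrix-valued differentiability along `x⁰` = entrywise (as in gen 8); here it is literally
Mathlib's `HasDerivAt` for the Pi (elementwise sup) norm, split by `hasDerivAt_pi`. (ADJ) as in gen 8: `U` is the
INVERSE transport (`∂₀U = λA₀U`), `g = U⁻¹` the (II.8) transformation (`∂₀g = −λgA₀`), both from `1` at the hyperplane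
`x₀ = 0` (tl.27–28). (PO)/(w) as in gen 8: the factor `λ` is restored in the exponent of (II.8) (the print omits it) and
the time-ordering of the Trotter product (our reading: later times on the left — NOT a phrase of the print) is the one
that makes `∂₀g = −λgA₀` — we do not re-adjudicate the left/right placement: the CONTENT typed is the initial-value problem, whose solution is unique (`solution_eq_mul_gaugeToAxial`),
so any path-ordered product solving it IS this `g`. (LINE) `A₀` is a continuous function of `x⁰` alone (one temporal
line at a time, the spatial point `x⃗` a parameter, exactly as (II.8) is written); measurability/continuity in `x⃗` of
the resulting `g(x⁰, x⃗)` is not addressed (not needed for the printed sentence, which is pointwise in `x⃗`).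

**Honest status / what is NOT claimed.** One-variable linear ODE theory applied to the printed (II.8): existence,
uniqueness, `SU(2)`-valuedness, and the periodicity criterion on the torus. As gen 8 recorded (record §3 (a′)), MRS
START from the postulated axial ansatz (II.9), so no typed statement of the tree moves; the torus criterion only makes
precise which gauge orbits of `T⁴` the ansatz `δ(A₀)` parametrises (those of trivial temporal holonomy), now for every
continuous `A₀` rather than for the abelian witness family. Nothing about MRS's measure, expansions or estimates;
nothing here is continuum Yang–Mills on `T⁴`, nothing lifts the infrared cutoff, nothing is about Bałaban's programme.
-/

namespace PathOrdered

open Complex Set Filter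
open scoped ComplexConjugate Topology
open Literature.Analysis.ODE


/-- `2 × 2` complex matrices (READING (M) of `…FiniteGaugeTransformations`: `G = SU(2) ⊂ GL₂(ℂ) ⊂ M₂(ℂ)`). [folklore] -/
abbrev Mat : Type := Matrix (Fin 2) (Fin 2) ℂ

attribute [local instance] Matrix.normedAddCommGroup Matrix.normedSpace

/-- Elementwise sup norm: `‖B X‖ ≤ 2‖B‖‖X‖` for `2 × 2` matrices (private plumbing). [folklore] -/
private theorem norm_mul_le_two (B X : Mat) : ‖B * X‖ ≤ 2 * ‖B‖ * ‖X‖ := by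
  rw [Matrix.norm_le_iff (by positivity)]
  intro i j
  rw [Matrix.mul_apply]
  calc ‖∑ k, B i k * X k j‖ ≤ ∑ k, ‖B i k * X k j‖ := norm_sum_le _ _
    _ ≤ ∑ _k : Fin 2, ‖B‖ * ‖X‖ := Finset.sum_le_sum fun k _ => by
        rw [norm_mul]
        exact mul_le_mul (Matrix.norm_entry_le_entrywise_sup_norm B) (Matrix.norm_entry_le_entrywise_sup_norm X)
          (norm_nonneg _) (norm_nonneg _)
    _ = 2 * ‖B‖ * ‖X‖ := by simp; ring

/-- `X ↦ c • (B X)` is Lipschitz with constant `2‖c‖‖B‖` (private plumbing). [folklore] -/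
private theorem lipschitzWith_smul_mul_left (c : ℂ) (B : Mat) :
    LipschitzWith (2 * ‖c‖ * ‖B‖).toNNReal fun X : Mat => c • (B * X) := by
  refine LipschitzWith.of_dist_le_mul fun X Y => ?_
  rw [dist_eq_norm, dist_eq_norm, ← smul_sub, ← Matrix.mul_sub, norm_smul,
    Real.coe_toNNReal _ (by positivity)]
  calc ‖c‖ * ‖B * (X - Y)‖ ≤ ‖c‖ * (2 * ‖B‖ * ‖X - Y‖) :=
        mul_le_mul_of_nonneg_left (norm_mul_le_two B (X - Y)) (norm_nonneg _)
    _ = 2 * ‖c‖ * ‖B‖ * ‖X - Y‖ := by ring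

/-- `X ↦ c • (X B)` is Lipschitz with constant `2‖c‖‖B‖` (private plumbing). [folklore] -/
private theorem lipschitzWith_smul_mul_right (c : ℂ) (B : Mat) :
    LipschitzWith (2 * ‖c‖ * ‖B‖).toNNReal fun X : Mat => c • (X * B) := by
  refine LipschitzWith.of_dist_le_mul fun X Y => ?_
  rw [dist_eq_norm, dist_eq_norm, ← smul_sub, ← Matrix.sub_mul, norm_smul,
    Real.coe_toNNReal _ (by positivity)]
  calc ‖c‖ * ‖(X - Y) * B‖ ≤ ‖c‖ * (2 * ‖X - Y‖ * ‖B‖) :=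
        mul_le_mul_of_nonneg_left (norm_mul_le_two (X - Y) B) (norm_nonneg _)
    _ = 2 * ‖c‖ * ‖B‖ * ‖X - Y‖ := by ring

/-! ## §2 The inverse temporal transport `U` (`∂₀U = λA₀U`, `U(0) = 1`) and the (II.8) transformation `g`
(`∂₀g = −λgA₀`, `g(0) = 1`) EXIST for every continuous `A₀` -/

variable (lam : ℝ) (A0 : ℝ → Mat)

/-- The vector field `X ↦ λA₀(x⁰)X` of the inverse-transport equation `∂₀U = λA₀U` (READING (ADJ)).
[cite: MagnenRivasseauSeneor1993, §II.A (II.8) p.329 tl.24–28] -/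
def invTransportField (t : ℝ) (X : Mat) : Mat := (lam : ℂ) • (A0 t * X)

/-- The vector field `X ↦ −λXA₀(x⁰)` of the (II.8) equation `∂₀g = −λgA₀` (⟺ `(A^g)₀ = 0`, gen 8's
`temporalComp_eq_zero_iff`). [cite: MagnenRivasseauSeneor1993, §II.A (II.7)–(II.8) p.329 tl.19–28] -/
def gaugeField (t : ℝ) (X : Mat) : Mat := (-(lam : ℂ)) • (X * A0 t)

variable {A0}

/-- For continuous `A₀` the inverse-transport field satisfies the global Cauchy–Lipschitz hypotheses on `ℝ`.
[cite: MagnenRivasseauSeneor1993, §II.A (II.8) p.329 tl.24–28] -/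
theorem isUniformlyLipschitzOn_invTransportField (hA : Continuous A0) :
    IsUniformlyLipschitzOn (invTransportField lam A0) univ := by
  refine ⟨fun X => ?_, fun C hC _ => ?_⟩
  · exact ((hA.matrix_mul continuous_const).const_smul (lam : ℂ)).continuousOn
  · obtain ⟨K, hK⟩ := hC.exists_bound_of_continuousOn hA.continuousOn
    refine ⟨(2 * ‖(lam : ℂ)‖ * K).toNNReal, fun t ht => ?_⟩
    refine (lipschitzWith_smul_mul_left (lam : ℂ) (A0 t)).weaken ?_
    exact Real.toNNReal_le_toNNReal (by gcongr; exact hK t ht)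

/-- For continuous `A₀` the (II.8) field satisfies the global Cauchy–Lipschitz hypotheses on `ℝ`.
[cite: MagnenRivasseauSeneor1993, §II.A (II.8) p.329 tl.24–28] -/
theorem isUniformlyLipschitzOn_gaugeField (hA : Continuous A0) :
    IsUniformlyLipschitzOn (gaugeField lam A0) univ := by
  refine ⟨fun X => ?_, fun C hC _ => ?_⟩
  · exact ((continuous_const.matrix_mul hA).const_smul (-(lam : ℂ))).continuousOn
  · obtain ⟨K, hK⟩ := hC.exists_bound_of_continuousOn hA.continuousOn
    refine ⟨(2 * ‖(-(lam : ℂ))‖ * K).toNNReal, fun t ht => ?_⟩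
    refine (lipschitzWith_smul_mul_right (-(lam : ℂ)) (A0 t)).weaken ?_
    exact Real.toNNReal_le_toNNReal (by gcongr; exact hK t ht)

variable (A0)

/-- **THE INVERSE TEMPORAL TRANSPORT `U(x⁰)`** (READING (ADJ) of gen 8, now CONSTRUCTED): the evolution map of
`∂₀U = λA₀U` from `U(0) = 1` (`Literature.Analysis.ODE.evolutionMap`; for continuous `A₀` it is THE solution, below).
[cite: MagnenRivasseauSeneor1993, §II.A (II.8) p.329 tl.24–28] -/
def invTransport (t : ℝ) : Mat := evolutionMap (invTransportField lam A0) 0 t 1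

/-- **THE (II.8) TRANSFORMATION `g(x⁰) = P exp(−λ∫₀^{x⁰}A₀)`** («indeed we can take (II.8)»): the evolution map of
`∂₀g = −λgA₀` from `g(0) = 1` at the hyperplane `x₀ = 0`. [cite: MagnenRivasseauSeneor1993, §II.A (II.8) p.329 tl.24–28] -/
def gaugeToAxial (t : ℝ) : Mat := evolutionMap (gaugeField lam A0) 0 t 1

/-- `U(0) = 1`. [cite: MagnenRivasseauSeneor1993, §II.A (II.8) p.329 tl.27–28] -/
@[simp]
theorem invTransport_zero : invTransport lam A0 0 = 1 := evolutionMap_self _ _ _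

/-- `g(0) = 1` («the path goes from {O, x⃗}, the point on the hyperplane x₀ = 0 to x»). [cite: MagnenRivasseauSeneor1993, §II.A (II.8) p.329 tl.27–28] -/
@[simp]
theorem gaugeToAxial_zero : gaugeToAxial lam A0 0 = 1 := evolutionMap_self _ _ _

variable {A0}

/-- **`∂₀U = λA₀U` on all of `ℝ`** for continuous `A₀` (global Cauchy–Lipschitz, `hasDerivAt_evolutionMap`).
[cite: MagnenRivasseauSeneor1993, §II.A (II.8) p.329 tl.24–28] -/
theorem hasDerivAt_invTransport (hA : Continuous A0) (t : ℝ) :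
    HasDerivAt (invTransport lam A0) ((lam : ℂ) • (A0 t * invTransport lam A0 t)) t :=
  (isUniformlyLipschitzOn_invTransportField lam hA).hasDerivAt_evolutionMap convex_univ (mem_univ 0) univ_mem 1

/-- **`∂₀g = −λgA₀` on all of `ℝ`** for continuous `A₀`: the (II.8) transformation EXISTS (and is differentiable) for
every continuous, non-abelian, `x⁰`-dependent time component. [cite: MagnenRivasseauSeneor1993, §II.A (II.8) p.329 tl.24–28] -/
theorem hasDerivAt_gaugeToAxial (hA : Continuous A0) (t : ℝ) :
    HasDerivAt (gaugeToAxial lam A0) (-((lam : ℂ) • (gaugeToAxial lam A0 t * A0 t))) t := by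
  have h := (isUniformlyLipschitzOn_gaugeField lam hA).hasDerivAt_evolutionMap convex_univ (mem_univ 0) univ_mem 1
    (t := t)
  rw [show -((lam : ℂ) • (gaugeToAxial lam A0 t * A0 t)) = gaugeField lam A0 t (gaugeToAxial lam A0 t) by
    simp [gaugeField, neg_smul, gaugeToAxial]]
  exact h

/-- Entrywise form of `∂₀U = λA₀U` (READING (E) of `…FiniteGaugeTransformations`; `hasDerivAt_pi` twice).
[cite: MagnenRivasseauSeneor1993, §II.A (II.8) p.329 tl.24–28] -/
theorem hasDerivAt_invTransport_entry (hA : Continuous A0) (t : ℝ) (i j : Fin 2) :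
    HasDerivAt (fun s => invTransport lam A0 s i j) (((lam : ℂ) • (A0 t * invTransport lam A0 t)) i j) t :=
  (hasDerivAt_pi.1 ((hasDerivAt_pi.1 (hasDerivAt_invTransport lam hA t)) i)) j

/-- Entrywise form of `∂₀g = −λgA₀`. [cite: MagnenRivasseauSeneor1993, §II.A (II.8) p.329 tl.24–28] -/
theorem hasDerivAt_gaugeToAxial_entry (hA : Continuous A0) (t : ℝ) (i j : Fin 2) :
    HasDerivAt (fun s => gaugeToAxial lam A0 s i j) ((-((lam : ℂ) • (gaugeToAxial lam A0 t * A0 t))) i j) t :=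
  (hasDerivAt_pi.1 ((hasDerivAt_pi.1 (hasDerivAt_gaugeToAxial lam hA t)) i)) j


/-! ## §3 (II.8) realises the axial gauge along every temporal line, for every continuous `A₀` -/

/-- **`g(x⁰)·U(x⁰) = 1`**: the (II.8) transformation is the inverse of the inverse transport (both exist now; the
identity is `…FiniteGaugeTransformations.solution_mul_invTransport_eq` with `g(0) = 1`). [cite: MagnenRivasseauSeneor1993, §II.A (II.8) p.329 tl.24–28] -/
theorem gaugeToAxial_mul_invTransport (hA : Continuous A0) (t : ℝ) :
    gaugeToAxial lam A0 t * invTransport lam A0 t = 1 := by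
  have h := solution_mul_invTransport_eq lam A0 (gaugeToAxial lam A0)
    (fun t => -((lam : ℂ) • (gaugeToAxial lam A0 t * A0 t))) (invTransport lam A0)
    (fun t => (lam : ℂ) • (A0 t * invTransport lam A0 t)) (fun t i j => hasDerivAt_gaugeToAxial_entry lam hA t i j)
    (fun _ => rfl) (fun t i j => hasDerivAt_invTransport_entry lam hA t i j) (fun _ => rfl)
    (invTransport_zero lam A0) t
  rw [h, gaugeToAxial_zero]

/-- … and `U(x⁰)·g(x⁰) = 1`. [cite: MagnenRivasseauSeneor1993, §II.A (II.8) p.329 tl.24–28] -/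
theorem invTransport_mul_gaugeToAxial (hA : Continuous A0) (t : ℝ) :
    invTransport lam A0 t * gaugeToAxial lam A0 t = 1 :=
  mul_eq_one_comm.mp (gaugeToAxial_mul_invTransport lam hA t)

/-- The (II.8) transformation is invertible at every `x⁰`. [cite: MagnenRivasseauSeneor1993, §II.A (II.8) p.329 tl.24–28] -/
theorem isUnit_det_gaugeToAxial (hA : Continuous A0) (t : ℝ) : IsUnit (gaugeToAxial lam A0 t).det :=
  Matrix.isUnit_det_of_right_inverse (gaugeToAxial_mul_invTransport lam hA t)

/-- Its inverse IS the inverse transport. [cite: MagnenRivasseauSeneor1993, §II.A (II.8) p.329 tl.24–28] -/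
theorem gaugeToAxial_inv (hA : Continuous A0) (t : ℝ) : (gaugeToAxial lam A0 t)⁻¹ = invTransport lam A0 t :=
  Matrix.inv_eq_right_inv (gaugeToAxial_mul_invTransport lam hA t)

/-- **p.329 tl.21–23 «This is a gauge condition that can be imposed in the sense that for any field configuration A there is
a gauge transformation such that A^g in (II.4) satisfies it; indeed we can take [(II.8)]» — PROVED along every temporal
line, for EVERY continuous
`A₀(x⁰)`** (general non-abelian, `x⁰`-dependent): `(A^g)₀ = 0` at every `x⁰` for `g` = the (II.8) transformation.
[cite: MagnenRivasseauSeneor1993, §II.A (II.7)–(II.8) p.329 tl.19–28] -/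
theorem temporalComp_gaugeToAxial (hlam : lam ≠ 0) (hA : Continuous A0) (t : ℝ) :
    temporalComp lam (gaugeToAxial lam A0 t) (-((lam : ℂ) • (gaugeToAxial lam A0 t * A0 t))) (A0 t) = 0 :=
  (temporalComp_eq_zero_iff lam hlam (isUnit_det_gaugeToAxial lam hA t) _ _).2 rfl

/-- **Uniqueness up to the residual group (p.329 tl.29–32):** every solution `g̃` of the axial-gauge equation along the
line is `g̃(0)·g` with `g` the (II.8) transformation. [cite: MagnenRivasseauSeneor1993, §II.A (II.7)–(II.8) p.329 tl.19–32] -/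
theorem solution_eq_mul_gaugeToAxial (hA : Continuous A0) (g g' : ℝ → Mat)
    (hg : ∀ t (i j : Fin 2), HasDerivAt (fun s => g s i j) (g' t i j) t)
    (hgeq : ∀ t, g' t = -((lam : ℂ) • (g t * A0 t))) (t : ℝ) : g t = g 0 * gaugeToAxial lam A0 t := by
  have h := solution_mul_invTransport_eq lam A0 g g' (invTransport lam A0)
    (fun t => (lam : ℂ) • (A0 t * invTransport lam A0 t)) hg hgeq
    (fun t i j => hasDerivAt_invTransport_entry lam hA t i j) (fun _ => rfl) (invTransport_zero lam A0) t
  calc g t = g t * (invTransport lam A0 t * gaugeToAxial lam A0 t) := by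
        rw [invTransport_mul_gaugeToAxial lam hA t, mul_one]
    _ = g 0 * gaugeToAxial lam A0 t := by rw [← mul_assoc, h]

/-! ## §4 `G = SU(2)`: for `su(2)`-valued `A₀` the (II.8) transformation is `SU(2)`-valued -/

/-- Entrywise product rule for matrix-valued functions of `x⁰` (private plumbing, as in `…FiniteGaugeTransformations`). [folklore] -/
private theorem hasDerivAt_mul_entry' (g g' U U' : ℝ → Mat) (s : ℝ)
    (hg : ∀ (i j : Fin 2), HasDerivAt (fun s => g s i j) (g' s i j) s)
    (hU : ∀ (i j : Fin 2), HasDerivAt (fun s => U s i j) (U' s i j) s) (i j : Fin 2) :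
    HasDerivAt (fun s => (g s * U s) i j) ((g' s * U s + g s * U' s) i j) s := by
  have hsum0 := HasDerivAt.fun_sum (u := Finset.univ) fun k _ => (hg i k).mul (hU k j)
  have e2 : ∑ k, (g' s i k * U s k j + g s i k * U' s k j) = (g' s * U s + g s * U' s) i j := by
    simp [Matrix.mul_apply, Matrix.add_apply, Finset.sum_add_distrib]
  rw [e2] at hsum0
  refine hsum0.congr_of_eventuallyEq (Filter.Eventually.of_forall fun r => ?_)
  simp [Matrix.mul_apply]

/-- **Unitarity**: if `A₀(x⁰)` is anti-Hermitian for all `x⁰` (the `su(2)` condition, p.328 tl.17–18, tl.26) then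
`g(x⁰)g(x⁰)ᴴ = 1` — the entries of `ggᴴ` have zero derivative (`(−λgA₀)gᴴ + g(−λgA₀)ᴴ = −λg(A₀ + A₀ᴴ)gᴴ = 0`, `λ` real).
[cite: MagnenRivasseauSeneor1993, §II.A p.328 tl.16–18, (II.8) p.329 tl.24–28] -/
theorem gaugeToAxial_mul_conjTranspose (hA : Continuous A0) (hskew : ∀ t, (A0 t)ᴴ = -A0 t) (t : ℝ) :
    gaugeToAxial lam A0 t * (gaugeToAxial lam A0 t)ᴴ = 1 := by
  set g := gaugeToAxial lam A0 with hgdef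
  have hd : ∀ s (i j : Fin 2), HasDerivAt (fun r => g r i j) ((-((lam : ℂ) • (g s * A0 s))) i j) s :=
    fun s i j => hasDerivAt_gaugeToAxial_entry lam hA s i j
  -- the conjugate transpose, entrywise
  have hdH : ∀ s (i j : Fin 2), HasDerivAt (fun r => (g r)ᴴ i j) ((-((lam : ℂ) • (g s * A0 s)))ᴴ i j) s := by
    intro s i j
    simp only [Matrix.conjTranspose_apply]
    exact (hd s j i).star
  have hF : ∀ (i j : Fin 2) (s : ℝ), HasDerivAt (fun r => (g r * (g r)ᴴ) i j) 0 s := by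
    intro i j s
    have h := hasDerivAt_mul_entry' g (fun s => -((lam : ℂ) • (g s * A0 s))) (fun s => (g s)ᴴ)
      (fun s => (-((lam : ℂ) • (g s * A0 s)))ᴴ) s (hd s) (hdH s) i j
    have hm : -((lam : ℂ) • (g s * A0 s)) * (g s)ᴴ + g s * (-((lam : ℂ) • (g s * A0 s)))ᴴ = 0 := by
      rw [Matrix.conjTranspose_neg, Matrix.conjTranspose_smul, Matrix.conjTranspose_mul, hskew s,
        Complex.star_def, Complex.conj_ofReal]
      simp only [Matrix.neg_mul, smul_neg, neg_neg, Matrix.smul_mul, Matrix.mul_smul, Matrix.mul_assoc]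
      abel
    rw [hm] at h
    simpa using h
  ext i j
  have hdiff : Differentiable ℝ (fun r => (g r * (g r)ᴴ) i j) := fun s => (hF i j s).differentiableAt
  have h := is_const_of_deriv_eq_zero hdiff (fun s => (hF i j s).deriv) t 0
  rw [h]
  simp [hgdef]

/-- **Unimodularity**: if `A₀(x⁰)` is traceless for all `x⁰` then `det g(x⁰) = 1` — Liouville: `(det g)′ = −λ tr(A₀) det g = 0`
(here for `2 × 2` matrices, entrywise). [cite: MagnenRivasseauSeneor1993, §II.A p.328 tl.16–18, (II.8) p.329 tl.24–28] -/
theorem det_gaugeToAxial (hA : Continuous A0) (htr : ∀ t, (A0 t).trace = 0) (t : ℝ) :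
    (gaugeToAxial lam A0 t).det = 1 := by
  set g := gaugeToAxial lam A0 with hgdef
  have hd : ∀ s (i j : Fin 2), HasDerivAt (fun r => g r i j) ((-((lam : ℂ) • (g s * A0 s))) i j) s :=
    fun s i j => hasDerivAt_gaugeToAxial_entry lam hA s i j
  have hF : ∀ s, HasDerivAt (fun r => (g r).det) 0 s := by
    intro s
    have h := ((hd s 0 0).mul (hd s 1 1)).sub ((hd s 0 1).mul (hd s 1 0))
    have htr' : A0 s 0 0 + A0 s 1 1 = 0 := by simpa [Matrix.trace_fin_two] using htr s
    have e : (-((lam : ℂ) • (g s * A0 s))) 0 0 * g s 1 1 + g s 0 0 * (-((lam : ℂ) • (g s * A0 s))) 1 1 -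
        ((-((lam : ℂ) • (g s * A0 s))) 0 1 * g s 1 0 + g s 0 1 * (-((lam : ℂ) • (g s * A0 s))) 1 0) = 0 := by
      have hA11 : A0 s 1 1 = -A0 s 0 0 := by linear_combination htr'
      simp only [Matrix.neg_apply, Matrix.smul_apply, Matrix.mul_apply, Fin.sum_univ_two, smul_eq_mul, hA11]
      ring
    rw [e] at h
    refine h.congr_of_eventuallyEq (Filter.Eventually.of_forall fun r => ?_)
    simp [Matrix.det_fin_two]
  have hdiff : Differentiable ℝ (fun r => (g r).det) := fun s => (hF s).differentiableAt
  have h := is_const_of_deriv_eq_zero hdiff (fun s => (hF s).deriv) t 0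
  rw [h]
  simp [hgdef]

/-- **The (II.8) transformation is `SU(2)`-valued for `su(2)`-valued `A₀`** («the functions x → g(x) from ℝ⁴ to G», p.328
tl.11, with `G = SU(2)`). [cite: MagnenRivasseauSeneor1993, §II.A p.328 tl.10–11 and tl.16–18, (II.8) p.329 tl.24–28] -/
theorem gaugeToAxial_mem_specialUnitaryGroup (hA : Continuous A0) (hskew : ∀ t, (A0 t)ᴴ = -A0 t)
    (htr : ∀ t, (A0 t).trace = 0) (t : ℝ) : gaugeToAxial lam A0 t ∈ Matrix.specialUnitaryGroup (Fin 2) ℂ := by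
  rw [Matrix.mem_specialUnitaryGroup_iff, Matrix.mem_unitaryGroup_iff]
  exact ⟨by rw [Matrix.star_eq_conjTranspose]; exact gaugeToAxial_mul_conjTranspose lam hA hskew t,
    det_gaugeToAxial lam hA htr t⟩

/-! ## §5 The torus: for `x⁰`-periodic `A₀`, a PERIODIC axialising transformation exists iff the temporal holonomy is
trivial — the general form of precision (u) -/

/-- If the inverse transport closes up, `U(T) = 1`, the (II.8) transformation is `T`-periodic (for `T`-periodic `A₀`):
`s ↦ g(s + T)` solves the same equation, so `g(s+T)U(s) = g(T) = U(T)⁻¹ = 1 = g(s)U(s)`.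
[cite: MagnenRivasseauSeneor1993, §II.A p.328 tl.6–12, (II.8) p.329 tl.24–28] -/
theorem gaugeToAxial_periodic (hA : Continuous A0) {T : ℝ} (hper : Function.Periodic A0 T)
    (hU : invTransport lam A0 T = 1) : Function.Periodic (gaugeToAxial lam A0) T := by
  intro t
  set g := gaugeToAxial lam A0 with hgdef
  have hgT : g T = 1 := by
    have := gaugeToAxial_mul_invTransport lam hA T
    rwa [hU, mul_one] at this
  have hd' : ∀ s (i j : Fin 2), HasDerivAt (fun r => g (r + T) i j) ((-((lam : ℂ) • (g (s + T) * A0 s))) i j) s := by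
    intro s i j
    have h := (hasDerivAt_gaugeToAxial_entry lam hA (s + T) i j).comp_add_const s T
    rwa [hper s] at h
  have h := solution_mul_invTransport_eq lam A0 (fun s => g (s + T)) (fun s => -((lam : ℂ) • (g (s + T) * A0 s)))
    (invTransport lam A0) (fun t => (lam : ℂ) • (A0 t * invTransport lam A0 t)) hd' (fun _ => rfl)
    (fun t i j => hasDerivAt_invTransport_entry lam hA t i j) (fun _ => rfl) (invTransport_zero lam A0) t
  simp only [zero_add, hgT] at h
  -- `g(t+T)` and `g(t)` are both left inverses of `U(t)`
  calc g (t + T) = g (t + T) * (invTransport lam A0 t * g t) := by rw [invTransport_mul_gaugeToAxial lam hA t, mul_one]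
    _ = g t := by rw [← mul_assoc, h, one_mul]

/-- **THE TORUS DICHOTOMY IN GENERAL (precision (u) of `…FiniteGaugeTransformations`, now for every continuous
`T`-periodic `A₀(x⁰)`, non-abelian and `x⁰`-dependent):** there is an `x⁰`-periodic, entrywise differentiable,
everywhere invertible matrix-valued `g` along the temporal circle with `(A^g)₀ = 0` everywhere IF AND ONLY IF the inverse
temporal transport closes up, `U(T) = 1` (trivial temporal holonomy). The forward direction is gen 8's
`invTransport_closes_of_periodic` with the datum `U` now CONSTRUCTED; the converse is the (II.8) transformation itself.
[cite: MagnenRivasseauSeneor1993, §II.A p.328 tl.6–12, (II.7)–(II.8) p.329 tl.19–28] -/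
theorem exists_periodic_gauge_to_axial_iff (hlam : lam ≠ 0) (hA : Continuous A0) {T : ℝ}
    (hper : Function.Periodic A0 T) :
    (∃ g g' : ℝ → Mat, (∀ t (i j : Fin 2), HasDerivAt (fun s => g s i j) (g' t i j) t) ∧ (∀ t, IsUnit (g t).det) ∧
        (∀ t, g (t + T) = g t) ∧ ∀ t, temporalComp lam (g t) (g' t) (A0 t) = 0) ↔
      invTransport lam A0 T = 1 := by
  constructor
  · rintro ⟨g, g', hd, hinv, hperg, hax⟩
    have hode : ∀ t, g' t = -((lam : ℂ) • (g t * A0 t)) :=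
      fun t => (temporalComp_eq_zero_iff lam hlam (hinv t) _ _).1 (hax t)
    exact invTransport_closes_of_periodic lam T A0 g g' (invTransport lam A0)
      (fun t => (lam : ℂ) • (A0 t * invTransport lam A0 t)) hd hode
      (fun t i j => hasDerivAt_invTransport_entry lam hA t i j) (fun _ => rfl) (invTransport_zero lam A0)
      (hinv 0) (by simpa using hperg 0)
  · intro hU
    exact ⟨gaugeToAxial lam A0, fun t => -((lam : ℂ) • (gaugeToAxial lam A0 t * A0 t)),
      fun t i j => hasDerivAt_gaugeToAxial_entry lam hA t i j, fun t => isUnit_det_gaugeToAxial lam hA t,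
      gaugeToAxial_periodic lam hA hper hU, fun t => temporalComp_gaugeToAxial lam hlam hA t⟩

/-- … and when it exists it may be taken `SU(2)`-valued (for `su(2)`-valued `A₀`).
[cite: MagnenRivasseauSeneor1993, §II.A p.328 tl.6–12 and tl.16–18, (II.7)–(II.8) p.329 tl.19–28] -/
theorem exists_periodic_su2_gauge_to_axial (hlam : lam ≠ 0) (hA : Continuous A0) {T : ℝ}
    (hper : Function.Periodic A0 T) (hskew : ∀ t, (A0 t)ᴴ = -A0 t) (htr : ∀ t, (A0 t).trace = 0)
    (hU : invTransport lam A0 T = 1) :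
    ∃ g g' : ℝ → Mat, (∀ t (i j : Fin 2), HasDerivAt (fun s => g s i j) (g' t i j) t) ∧
      (∀ t, g t ∈ Matrix.specialUnitaryGroup (Fin 2) ℂ) ∧ (∀ t, g (t + T) = g t) ∧
      ∀ t, temporalComp lam (g t) (g' t) (A0 t) = 0 :=
  ⟨gaugeToAxial lam A0, fun t => -((lam : ℂ) • (gaugeToAxial lam A0 t * A0 t)),
    fun t i j => hasDerivAt_gaugeToAxial_entry lam hA t i j,
    fun t => gaugeToAxial_mem_specialUnitaryGroup lam hA hskew htr t, gaugeToAxial_periodic lam hA hper hU,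
    fun t => temporalComp_gaugeToAxial lam hlam hA t⟩

/-! ## §5b Uniqueness of the inverse transport; gauge covariance of the temporal holonomy, unconditionally -/

/-- An entrywise differentiable matrix-valued function of `x⁰` is continuous (private plumbing). [folklore] -/
private theorem continuous_of_hasDerivAt_entry {h h' : ℝ → Mat}
    (hh : ∀ t (i j : Fin 2), HasDerivAt (fun s => h s i j) (h' t i j) t) : Continuous h :=
  continuous_pi fun i => continuous_pi fun j => continuous_iff_continuousAt.2 fun t => (hh t i j).continuousAt

/-- **The transformed time component `(A^h)₀ = hA₀h⁻¹ + λ⁻¹∂₀h·h⁻¹` (II.4) is continuous** along the line when `A₀` is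
continuous and `h` is entrywise `C¹` and everywhere invertible (matrix inversion is continuous at invertible matrices).
[cite: MagnenRivasseauSeneor1993, §II.A (II.4) p.329 tl.4–5] -/
theorem continuous_temporalComp (hA : Continuous A0) {h h' : ℝ → Mat}
    (hh : ∀ t (i j : Fin 2), HasDerivAt (fun s => h s i j) (h' t i j) t) (hh' : Continuous h')
    (hhinv : ∀ t, IsUnit (h t).det) : Continuous fun t => temporalComp lam (h t) (h' t) (A0 t) := by
  have hhc : Continuous h := continuous_of_hasDerivAt_entry hh
  have hinv : Continuous fun t => (h t)⁻¹ := by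
    refine continuous_iff_continuousAt.2 fun t => ?_
    have hc : ContinuousAt Ring.inverse (h t).det := by
      obtain ⟨u, hu⟩ := hhinv t
      rw [← hu]
      exact NormedRing.inverse_continuousAt u
    exact (continuousAt_matrix_inv (h t) hc).comp hhc.continuousAt
  have h1 : Continuous fun t => h t * A0 t * (h t)⁻¹ := (hhc.matrix_mul hA).matrix_mul hinv
  have h2 : Continuous fun t => h' t * (h t)⁻¹ := hh'.matrix_mul hinv
  have h3 : Continuous fun t => ((lam : ℂ)⁻¹) • (h' t * (h t)⁻¹) := by
    have := h2.const_smul ((lam : ℂ)⁻¹)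
    simpa only [Pi.smul_def] using this
  unfold temporalComp
  exact h1.add h3

/-- **Uniqueness of the inverse transport**: any entrywise differentiable `V` with `∂₀V = λA₀V`, `V(0) = 1` IS `U`
(`gV = 1` by gen 8's identity, and `g⁻¹ = U`). [cite: MagnenRivasseauSeneor1993, §II.A (II.8) p.329 tl.24–28] -/
theorem eq_invTransport (hA : Continuous A0) (V V' : ℝ → Mat)
    (hV : ∀ t (i j : Fin 2), HasDerivAt (fun s => V s i j) (V' t i j) t)
    (hVeq : ∀ t, V' t = (lam : ℂ) • (A0 t * V t)) (hV0 : V 0 = 1) (t : ℝ) : V t = invTransport lam A0 t := by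
  have h := solution_mul_invTransport_eq lam A0 (gaugeToAxial lam A0)
    (fun t => -((lam : ℂ) • (gaugeToAxial lam A0 t * A0 t))) V V'
    (fun t i j => hasDerivAt_gaugeToAxial_entry lam hA t i j) (fun _ => rfl) hV hVeq hV0 t
  rw [gaugeToAxial_zero] at h
  rw [← gaugeToAxial_inv lam hA t]
  exact (Matrix.inv_eq_right_inv h).symm

/-- **Gauge covariance of the inverse transport, unconditional** (gen 8's `invTransport_gauge_covariant` with the datum
`U` constructed): for an entrywise `C¹`, everywhere invertible `h` along the line, the inverse transport of the transformed
time component `(A^h)₀ = hA₀h⁻¹ + λ⁻¹∂₀h·h⁻¹` (II.4) is `h U h(0)⁻¹`.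
[cite: MagnenRivasseauSeneor1993, §II.A (II.4) p.329 tl.4–5, (II.8) tl.24–28] -/
theorem invTransport_gaugeAct (hlam : lam ≠ 0) (hA : Continuous A0) (h h' : ℝ → Mat)
    (hh : ∀ t (i j : Fin 2), HasDerivAt (fun s => h s i j) (h' t i j) t) (hh' : Continuous h')
    (hhinv : ∀ t, IsUnit (h t).det) (t : ℝ) :
    invTransport lam (fun t => temporalComp lam (h t) (h' t) (A0 t)) t = h t * invTransport lam A0 t * (h 0)⁻¹ := by
  symm
  exact eq_invTransport lam (continuous_temporalComp lam hA hh hh' hhinv) (fun s => h s * invTransport lam A0 s * (h 0)⁻¹)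
    (fun s => (lam : ℂ) • (temporalComp lam (h s) (h' s) (A0 s) * (h s * invTransport lam A0 s * (h 0)⁻¹)))
    (fun s i j => invTransport_gauge_covariant lam hlam A0 h h' (invTransport lam A0)
      (fun t => (lam : ℂ) • (A0 t * invTransport lam A0 t)) hh hhinv
      (fun t i j => hasDerivAt_invTransport_entry lam hA t i j) (fun _ => rfl) s i j)
    (fun _ => rfl) (invTransport_gauge_initial h (invTransport lam A0) (hhinv 0) (invTransport_zero lam A0)) t

/-- **Triviality of the temporal holonomy is GAUGE INVARIANT, unconditionally**: for `T`-periodic such `h`,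
`U_{A^h}(T) = 1 ⟺ U_A(T) = 1` (gen 8's `holonomy_trivial_iff_conj`). So on the torus no periodic gauge transformation
moves a configuration between the two cases of `exists_periodic_gauge_to_axial_iff`.
[cite: MagnenRivasseauSeneor1993, §II.A p.328 tl.10–12, (II.4) p.329 tl.4–5, (II.7)–(II.8) tl.19–28] -/
theorem invTransport_gaugeAct_eq_one_iff (hlam : lam ≠ 0) (hA : Continuous A0) (h h' : ℝ → Mat)
    (hh : ∀ t (i j : Fin 2), HasDerivAt (fun s => h s i j) (h' t i j) t) (hh' : Continuous h')
    (hhinv : ∀ t, IsUnit (h t).det) {T : ℝ} (hper : h T = h 0) :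
    invTransport lam (fun t => temporalComp lam (h t) (h' t) (A0 t)) T = 1 ↔ invTransport lam A0 T = 1 := by
  rw [invTransport_gaugeAct lam hlam hA h h' hh hh' hhinv T]
  exact holonomy_trivial_iff_conj h (invTransport lam A0) T (hhinv 0) hper

/-! ## §6 Consistency with gen 8's explicit witness family `A₀ ≡ a·t₃` -/

/-- For the constant abelian time component `A₀ ≡ a·t₃` the (II.8) transformation IS gen 8's explicit
`transport λ a = diag(e^{−iλat/2}, e^{iλat/2})` (uniqueness). [cite: MagnenRivasseauSeneor1993, §II.A (II.8) p.329 tl.24–28] -/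
theorem gaugeToAxial_const_cartan (lam a t : ℝ) : gaugeToAxial lam (fun _ => cartan a) t = transport lam a t := by
  have h := solution_eq_mul_gaugeToAxial lam (A0 := fun _ => cartan a) continuous_const (fun s => transport lam a s)
    (fun s => -((lam : ℂ) • (transport lam a s * cartan a))) (fun s i j => hasDerivAt_transport lam a s i j)
    (fun _ => rfl) t
  rw [transport_zero, one_mul] at h
  exact h.symm

/-- … and the inverse transport IS gen 8's `transport λ (−a)` (its `hasDerivAt_invTransport`).
[cite: MagnenRivasseauSeneor1993, §II.A (II.8) p.329 tl.24–28] -/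
theorem invTransport_const_cartan (lam a t : ℝ) : invTransport lam (fun _ => cartan a) t = transport lam (-a) t := by
  have h1 : transport lam a t * transport lam (-a) t = 1 := by
    have h := solution_mul_invTransport_eq lam (fun _ => cartan a) (fun s => transport lam a s)
      (fun s => -((lam : ℂ) • (transport lam a s * cartan a))) (fun s => transport lam (-a) s)
      (fun s => (lam : ℂ) • (cartan a * transport lam (-a) s)) (fun s i j => hasDerivAt_transport lam a s i j)
      (fun _ => rfl) (fun s i j => FiniteGauge.hasDerivAt_invTransport lam a s i j) (fun _ => rfl)
      (transport_zero lam (-a)) t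
    rwa [transport_zero] at h
  have h2 := gaugeToAxial_inv lam (A0 := fun _ => cartan a) continuous_const t
  rw [gaugeToAxial_const_cartan] at h2
  rw [← h2]
  exact Matrix.inv_eq_right_inv h1

/-- **The general criterion specialises to gen 8's dichotomy:** for `A₀ ≡ a·t₃`, `U(T) = 1 ⟺ λaT/(4π) ∈ ℤ` (gen 8's
`transport_eq_one_iff`); with `exists_periodic_gauge_to_axial_iff` this is `no_periodic_gauge_to_axial` /
`exists_periodic_gauge_to_axial` again. [cite: MagnenRivasseauSeneor1993, §II.A p.328 tl.10–12, (II.7)–(II.8) p.329 tl.19–28] -/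
theorem invTransport_const_cartan_eq_one_iff (lam a T : ℝ) :
    invTransport lam (fun _ => cartan a) T = 1 ↔ ∃ n : ℤ, lam * a * T = 4 * Real.pi * n := by
  rw [invTransport_const_cartan, transport_eq_one_iff]
  constructor
  · rintro ⟨n, hn⟩
    exact ⟨-n, by push_cast; linarith⟩
  · rintro ⟨n, hn⟩
    exact ⟨-n, by push_cast; linarith⟩

end PathOrdered

end FiniteGauge

end Literature.MathematicalPhysics.QuantumFieldTheory.MagnenRivasseauSeneor1993
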